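import Literature.NumberTheory.ComplexMultiplication.CMAlgebraLatticeInvertibleGroup
import Literature.NumberTheory.ComplexMultiplication.CMAlgebraLatticeGorenstein
import HarnessLib

/-!
# WEAK EQUIVALENCE of full lattices in a CM-ALGEBRA `Y = L_1 ⊕ ⋯ ⊕ L_t`: `L_1 ∼_w L_2` ⟺ `1 ∈ (L_1:L_2)(L_2:L_1)`
# ⟺ `𝒪(L_1) = 𝒪(L_2)` and `L_2 = L_1L_3` with `L_3 ∈ G(𝒪(L_1))`, and then `L_3 = L_2:L_1` is UNIQUE; `G(Λ) = [Λ]_w`;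
# the bijections `G(Λ) → [L_1]_w`, `L_3 ↦ L_3L_1`; `Pic(Λ)` acts FREELY on `ICM_Λ` with quotient the weak classes,
# so `#ICM_Λ = #Pic(Λ)·#W̄(Λ)`, and `#W̄(Λ) = 1` iff `Λ` is Gorenstein (Hertling–Larabi 2026 Thm. 4.4, Thm. 5.7,
# Thm. 5.8 = Dade–Taussky–Zassenhaus 1962; Marseglia 2019 Prop. 4.1, Cor. 4.5, Thm. 4.6)

Topic `Literature/NumberTheory/ComplexMultiplication`, namespace `Literature.NumberTheory.ComplexMultiplication`;
lane `lit-hodgefound` (Track 2 foundations library), Layer A3, seat p19 generation 32, row g32-#1 — sequel of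
g31-#5 (`CMAlgebraLatticeSemigroup`: the semigroup `𝓛(Y)` of full `ℤ`-lattices `M ⊂ Y` under Mathlib's product of
`Submodule ℤ Y`, colon `M / N = {a | aN ⊆ M}`, order `𝒪(M) = M / M`, Krull's lemma `one_mem_of_mul_le_of_mul_eq`,
invertibility «`M·((M/M)/M) = M/M`» with `M⁻¹ = (M/M)/M`), g31-#9 (`CMAlgebraLatticeInvertibleGroup`: the groups
`G(Λ)`, `(M⁻¹)⁻¹ = M`), g31-#2 (`CMAlgebraTorusIsomorphismClassesLatticeClasses`: the `ε`-classes `[M]_ε = {uM}`,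
the finite strata `ICM_S = {[M]_ε | 𝒪(M) = S}` and their dictionary with `Y`-isomorphism classes of CM tori) and
g31-#8 (`CMAlgebraLatticeGorenstein`: Marseglia's Prop. 2.10).  THEOREMS ONLY: no definition, no instance, no
named fact (D-0026, net Literature debt `0`), no `sorry`.  «`L_1` and `L_2` are weakly equivalent» is WRITTEN, never
defined: as Hertling–Larabi's (i) `∃ L_3 L_4, L_1L_3 = L_2 ∧ L_2L_4 = L_1` or as the criterion (ii) = Marseglia's
(b) `1 ∈ (L_1:L_2)(L_2:L_1)`, which the file proves equivalent; «`L_3 ∈ G(Λ)`» is written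
`L_3/L_3 = Λ ∧ L_3·((L_3/L_3)/L_3) = L_3/L_3`.

RELATION TO THE TREE: for ONE number field `K` and the carrier `FractionalIdeal (endOrder ρ)⁰ K`, Marseglia's
Prop. 4.1 (b) ⟺ (c), Cor. 4.5 and Thm. 4.6 are seat p15's `CMOrderWeakEquivalence` (`EndOrder.div_mul_eq_of_one_mem`,
`EndOrder.eq_div_self_of_mul_eq_self`, …) and `CMOrderWeakClassesCount`
(`EndOrder.natCard_quot_stratum_eq_natCard_quot_weak_mul_natCard_quot_pic`), with the Gorenstein count in
`CMOrderGorensteinWeakClassesCount`.  The present file is the CM-ALGEBRA version in the Dade–Taussky–Zassenhaus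
semigroup `𝓛(Y)` of arbitrary full `ℤ`-lattices of `Y = ∏ᵢ Lᵢ` (zero divisors allowed) — Hertling–Larabi's own
setting «`A` a finite dimensional commutative ℚ-algebra» specialised to the separable `A = Y`, and Marseglia's «`K` a
finite product of number fields» — i.e. the vocabulary the CM-algebra tori of the lane live in; it imports nothing
from and restates nothing of the one-field files (different carrier, sub-namespace `EndOrder`).

## Sources, VERBATIM

C. Hertling, K. Larabi, *Semigroups from full lattices in commutative ℚ-algebras*, arXiv:2602.14973 (2026)
[HertlingLarabi2026], held `paper:arxiv-2602.14973`.  §4 (chunks p0009–p0010): «**Definition 4.3.** […] (b) Let `S`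
be a commutative semigroup. Two elements `a_1` and `a_2 ∈ S` are `w`-equivalent (notation: `a_1 ∼_w a_2`), if the
following holds: `a_1 = a_2` or `∃ x_1, x_2 ∈ S` with `a_1x_1 = a_2, a_2x_2 = a_1`. […] **Theorem 4.4** (DTZ62). Let
`S` be a commutative semigroup. (a) `∼_w` is an equivalence relation and is compatible with the multiplication in
`S`, i.e. `a_1 ∼_w a_2, b_1 ∼_w b_2 ⇒ a_1b_1 ∼_w a_2b_2`. […] (b) If `a` is invertible then `[a]_w = G(e_a)`. (c) Let
`a ∈ S`. The following three properties are equivalent: (i) `a` is invertible. (ii) `[a]_w` is invertible (in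
`W(S)`). (iii) `[a]_w` is idempotent (in `W(S)`).»  §5 (chunks p0013–p0014): «**Theorem 5.7** (DTZ62). (a) Let
`L_1, L_2 ∈ 𝓛(A)`. The following four properties are equivalent. (i) `L_1 ∼_w L_2`. (ii) `1 ∈ (L_1:L_2)(L_2:L_1)`.
(iii) `𝒪(L_1) = 𝒪(L_2)` and `L_3 ∈ G(𝒪(L_1))` with `L_1L_3 = L_2` exists. (iv) `[L_1]_ε ∼_w [L_2]_ε`. (b) Let
`L_1, L_2 ∈ 𝓛(A)` with `L_1 ∼_w L_2`. We have `L_1:L_2 ∈ G(𝒪(L_1))`, `L_2:L_1 ∈ G(𝒪(L_1))`,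
`(L_1:L_2)⁻¹ = L_2:L_1`, `L_2 = (L_2:L_1)L_1`, `L_1 = (L_1:L_2)L_2`,
`𝒪(L_1) = 𝒪(L_2) = 𝒪(L_1:L_2) = 𝒪(L_2:L_1) = (L_1:L_2)(L_2:L_1)`. (c) `W(𝓛(A)) = W(𝓔(A))`, and this semigroup
inherits a division map from the division map on `𝓛(A)`. *Proof:* (a) (i)⇒(ii): […] `L_1(L_2:L_1) = L_2` and
`L_2(L_1:L_2) = L_1` […] Lemma 5.2 (c) (Krull's lemma) can be applied and yields `1 ∈ (L_1:L_2)(L_2:L_1)`, because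
of […] `L_2(L_1:L_2)(L_2:L_1) = L_1(L_2:L_1) = L_2`, `((L_1:L_2)(L_2:L_1))² ⊂ (L_1:L_2)(L_2:L_1)(L_1:L_1) =
(L_1:L_2)(L_2:L_1)`. (ii)⇒(iii): Define `Λ := (L_1:L_2)(L_2:L_1)`. […] `Λ` is an order. It contains `𝒪(L_1)`
and `𝒪(L_2)` […] It is contained in `L_1:L_1 = 𝒪(L_1)` and in `L_2:L_2 = 𝒪(L_2)` […] Therefore
`𝒪(L_1) = Λ = 𝒪(L_2)`. This is also equal to `𝒪(L_1:L_2)` and `𝒪(L_2:L_1)` […] `L_2 = L_2Λ ⊂ L_1(L_2:L_1) ⊂ L_2`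
[…] (iii)⇒(i): `L_1L_3 = L_2` and `L_2L_3⁻¹ = L_1L_3L_3⁻¹ = L_1𝒪(L_1) = L_1` […] (c) Suppose `L_1 ∼_ε L_2`. […]
`L_1a𝒪(L_1) = L_2` and `L_2a⁻¹𝒪(L_1) = L_1`, so `L_1 ∼_w L_2`. […] `L_3 ∼_w L_5, L_4 ∼_w L_6 ⇒ L_3:L_4 ∼_w L_5:L_6`.
We calculate `L_3:L_4 ⊃ (L_3:L_5)(L_5:L_6)(L_6:L_4) ⊃ (L_3:L_5)(L_5:L_3)(L_3:L_4)(L_4:L_6)(L_6:L_4) =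
𝒪(L_3)(L_3:L_4)𝒪(L_4) = (L_3:L_4)`, so `L_3:L_4 = (L_5:L_6)((L_3:L_5)(L_6:L_4))` […] **Theorem 5.8.** (a) Let
`L_1, L_2 ∈ 𝓛(A)` with `L_1 ∼_w L_2`. Then `𝒪(L_1) = 𝒪(L_2)`. The only full lattice `L_3` with `L_1L_3 = L_2` and
`L_3 ∈ G(𝒪(L_1))` is `L_3 = L_2:L_1`. (b) Let `Λ` be an order and `L_1 ∈ 𝓛(A)` with `𝒪(L_1) = Λ`. Then
`G(Λ) = [Λ]_w` and `G([Λ]_ε) = [[Λ]_ε]_w`. The maps `G(Λ) → [L_1]_w, L_3 ↦ L_3L_1`, `G([Λ]_ε) → [[L_1]_ε]_w,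
[L_3]_ε ↦ [L_3]_ε[L_1]_ε`, are well defined and bijections. *Proof:* (a) […] Suppose `L_3 ∈ G(𝒪(L_1))` with
`L_1L_3 = L_2`. Then `L_3 ⊂ L_2:L_1`. Also `L_1 = L_2L_3⁻¹` which implies `L_3⁻¹ ⊂ L_1:L_2`. This last inclusion
implies `L_3 ⊃ (L_1:L_2)⁻¹ = L_2:L_1`. Therefore `L_3 = L_2:L_1`. (b) […] for `L_3 ∈ G(Λ)`, `L_1·L_3 = L_3L_1,
(L_3L_1)·L_3⁻¹ = L_1`, so `L_3L_1 ∼_w L_1`. It is surjective because of (i)⇒(iii) in Theorem 5.7 (a). It is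
injective because of part (a). The map in (5.13) is bijective because the map in (5.12) is bijective and because
it respects `ε`-classes.»; and before Thm. 5.8: «(5.13) in Theorem 5.8 says that this set [`{[L]_ε | 𝒪(L) = Λ}`]
decomposes into finitely many `w`-classes which have all the same size, one of them being `G([Λ]_ε)`.»

S. Marseglia, *Computing the ideal class monoid of an order*, J. Lond. Math. Soc. (2) 101 (2020) 984–1007,
arXiv:1805.09671 [Marseglia2019], held `paper:arxiv-1805.09671`, §4 (chunks p0008–p0009): «**Proposition 4.1.**
Let `I` and `J` be two fractional `R`-ideals. The following are equivalent: (a) `I_𝔭` and `J_𝔭` are isomorphic for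
every prime `𝔭` of `R`; (b) `1 ∈ (I:J)(J:I)`; (c) `I` and `J` have the same multiplicator ring, say `S`, and there
exists an ideal `L` invertible in `S` such that `I = LJ`. […] **Definition 4.2.** If two fractional `R`-ideals `I`
and `J` satisfy the equivalent conditions of Proposition 4.1 we say that they are weakly equivalent. […] an ideal is
invertible if and only if it is weakly equivalent to its multiplicator ring and hence we have that `W̄k(S) = {[S]}`
if and only if `S` is Gorenstein. […] **Corollary 4.5.** Let `I` and `J` be two weakly equivalent fractional
`R`-ideals, and let `S` be their multiplicator ring. Then `I = (I:J)J`, and `(I:J)` is a fractional ideal invertible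
in `S`. In particular, `I ≃ J` if and only if `(I:J)` is a principal fractional `S`-ideal. […] Conversely, if
`I = xJ` […] `(I:J) = (xJ:J) = x(J:J) = xS` […] **Theorem 4.6.** Let `R` be an order in `K`. For every over-order
`S` of `R`, the action of `Pic(S)` on `ICM̄(S)` induced by ideal multiplication is free and `W̄k(S) = ICM̄(S)/Pic(S)`.
More concretely, if `W̄k(S) = {[I_1], …, [I_r]}` and `Pic(S) = {[J_1], …, [J_s]}` […] then
`ICM̄(S) = {[I_iJ_j] : 1 ≤ i ≤ r, 1 ≤ j ≤ s}` and the fractional ideals `I_iJ_j` are pairwise not isomorphic. […] it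
is enough to prove that if `I = IJ` with `I` and `J` both having multiplicator ring `S` and `J` invertible in `S`,
then `J = S`.»

## What is proved (`Y = ∏ᵢ Lᵢ` number fields; `A, B, C, I, J, M, N, Lⱼ, Λ, R : Submodule ℤ Y`)

* §0 COLON CALCULUS: `div_mul_div_le_div` (`(A:B)(B:C) ⊆ (A:C)`), `div_mul_div_le_div_self`
  (`(L_1:L_2)(L_2:L_1) ⊆ 𝒪(L_1)`), `div_self_mul_div_eq` (`𝒪(A)(A:B) = (A:B)`), `div_mul_div_self_eq`
  (`(A:B)𝒪(B) = (A:B)`), `mul_div_eq_of_mul_eq` (`L_1L_3 = L_2 ⟹ L_1(L_2:L_1) = L_2`), and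
  `one_mem_div_mul_div_of_eq_mul` (`I = AJ`, `J = BI`, `1 ∈ AB ⟹ 1 ∈ (I:J)(J:I)` — the unit-free half of
  Prop. 4.1 (c) ⟹ (b)).
* §1 THEOREM 5.7 (a), (b) ∕ PROP. 4.1 (b) ⟺ (c) ∕ COR. 4.5: **`one_mem_div_mul_div_of_mul_eq_of_mul_eq`** ((i) ⟹ (ii),
  by Krull's lemma), and from (ii) — WITHOUT any fullness hypothesis — **`div_mul_div_eq_div_self_of_one_mem`**
  (`(L_1:L_2)(L_2:L_1) = 𝒪(L_1)`), **`div_self_eq_div_self_of_one_mem`** (`𝒪(L_1) = 𝒪(L_2)`), **`div_mul_eq_of_one_mem`**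
  (`(L_2:L_1)L_1 = L_2`, Cor. 4.5), `div_self_div_eq_div_self_of_one_mem` (`𝒪(L_1:L_2) = 𝒪(L_1)`),
  `div_mul_inv_eq_of_one_mem` (`L_1:L_2` is invertible), **`div_self_div_div_eq_of_one_mem`**
  (`(L_1:L_2)⁻¹ = L_2:L_1`), `one_mem_div_mul_div_of_invertible_mul_eq` ((iii) ⟹ (ii)), packaged as
  **`one_mem_div_mul_div_iff_exists_mul_eq`** ((ii) ⟺ (i), full `L_1, L_2`),
  **`one_mem_div_mul_div_iff_exists_invertible_mul_eq`** ((ii) ⟺ (iii), any `L_1, L_2`) and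
  `exists_units_smul_mul_eq_iff_exists_mul_eq` ((iv) ⟺ (i)).
* §2 THEOREM 4.4 (a) IN `𝓛(Y)` and THEOREM 5.7 (c): `one_mem_div_self_mul_div_self` (reflexive),
  `one_mem_div_mul_div_comm` (symmetric), `one_mem_div_mul_div_trans` (transitive), `equivalence_one_mem_div_mul_div`
  (an `Equivalence` on every family of lattices), **`one_mem_div_mul_div_mul`** ((4.5): compatible with products),
  **`one_mem_div_mul_div_of_units_smul_eq`** (`L_1 ∼_ε L_2 ⟹ L_1 ∼_w L_2`, so `W(𝓛(Y)) = W(𝓔(Y))`),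
  **`div_eq_div_mul_of_one_mem_of_one_mem`** (`L_3:L_4 = (L_5:L_6)((L_3:L_5)(L_6:L_4))`) and
  **`one_mem_div_div_mul_div_div`** ((5.9): `∼_w` is compatible with the division map).
* §3 THEOREM 5.8 (a), (b) ∕ THEOREM 4.4 (b), (c): **`eq_div_of_invertible_mul_eq`** (the `L_3 ∈ G(𝒪(L_1))` with
  `L_1L_3 = L_2` is `L_2:L_1` — UNIQUENESS), **`one_mem_div_mul_div_order_iff`** ((5.11) `G(Λ) = [Λ]_w`: for an
  order `Λ`, `M ∼_w Λ ⟺ M ∈ G(Λ)`), `one_mem_div_mul_div_iff_of_invertible` (Thm. 4.4 (b): `[L_1]_w = G(𝒪(L_1))`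
  for invertible `L_1`), **`one_mem_div_mul_div_iff_existsUnique`** ((5.12): `L_2 ∼_w L_1 ⟺ ∃! L_3 ∈ G(𝒪(L_1)),
  L_3L_1 = L_2`), `one_mem_div_mul_self_mul_div_iff` (Thm. 4.4 (c) (i) ⟺ (iii): `L` invertible ⟺ `LL ∼_w L`, full
  `L`), and FREENESS at lattice level **`units_smul_eq_div_self_of_units_smul_mul_eq`** (`u(L_3L_1) = L_1`,
  `L_3 ∈ G(𝒪(L_1))` ⟹ `uL_3 = 𝒪(L_1)` — «if `I = IJ` … then `J = S`», up to the unit).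
* §4 THE CLASS SETS OF AN ORDER `R` (`ICM_R = {M full | 𝒪(M) = R}/ε`, `Pic(R)` = its invertible part `/ε`,
  `W̄(R) = {M full | 𝒪(M) = R}/∼_w`): finiteness
  **`finite_quot_isFullLattice_div_self_eq`** (HL Thm. 6.5, transported from g31-#2's `Subring`-indexed stratum by
  `nonempty_quot_div_self_eq_equiv_quot_subring`), `finite_quot_weak_div_self_eq`, `finite_quot_pic_div_self_eq`;
  THEOREM 4.6 ∕ (5.13): **`natCard_fiber_weak_eq_natCard_quot_pic`** (every fibre of `ICM_R → W̄(R)` is a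
  `Pic(R)`-torsor: `[L_3]_ε ↦ [L_3L_1]_ε` is a bijection `Pic(R) → [[L_1]_ε]_w`), and the COUNT
  **`natCard_quot_div_self_eq_eq_natCard_quot_pic_mul_natCard_quot_weak`** (`#ICM_R = #Pic(R)·#W̄(R)`).
* §5 GORENSTEIN: `natCard_quot_weak_div_self_eq_eq_one_iff_forall` (`#W̄(R) = 1 ⟺` every lattice with order `R` is
  invertible), **`natCard_quot_weak_div_self_eq_eq_one_iff`** (for an order `R`: `#W̄(R) = 1 ⟺ R^t·(R:R^t) = R`,
  «`W̄k(S) = {[S]}` iff `S` is Gorenstein», through g31-#8's Prop. 2.10 (2) ⟺ (3)), and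
  `natCard_quot_div_self_eq_eq_natCard_quot_pic_iff` (`#ICM_R = #Pic(R) ⟺ R` Gorenstein).
* §6 AT TORUS LEVEL (g31-#2's dictionary): **`IsCMAlgTorusRat.natCard_quot_sublattice_order_eq_eq_mul`** — the number
  of `Y`-isomorphism classes of CM-algebra tori `(X_A, ρ_A)` whose endomorphism order `ρ_A⁻¹(M_ι(ℤ))` is EXACTLY `S`
  equals `#Pic(S)·#W̄(S)` («Fixing the multiplicator ring is a key point»).

## References
* [HertlingLarabi2026] C. Hertling, K. Larabi, arXiv:2602.14973 (2026), §4 Def. 4.3, Thm. 4.4 (chunks p0009–p0010);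
  §5 Def. 5.4, Lemma 5.5, Thm. 5.7, Thm. 5.8, (5.9)–(5.13) (chunks p0013–p0014); §6 Thm. 6.5 (chunk p0015).
  [cite: HertlingLarabi2026, §5 Thm. 5.7, chunk p0013]
* [DadeTausskyZassenhaus1962] E. C. Dade, O. Taussky, H. Zassenhaus, *On the theory of orders, in particular on the
  semigroup of ideal classes and genera of an order in an algebraic number field*, Math. Ann. 148 (1962) 31–64
  (Thm. 4.4 and Thm. 5.7 are attributed to it; «proved in [DTZ62] in the particular case of an integral domain»).
  [cite: DadeTausskyZassenhaus1962, §1]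
* [Marseglia2019] S. Marseglia, J. LMS (2) 101 (2020) 984–1007, arXiv:1805.09671, §4 Prop. 4.1, Def. 4.2, Cor. 4.5,
  Thm. 4.6, Remark 4.7 (chunks p0008–p0009). [cite: Marseglia2019, §4 Thm. 4.6, chunk p0009]
-/

noncomputable section

open scoped Classical Matrix Pointwise nonZeroDivisors NumberField
open Module Matrix NumberField Function

namespace Literature.NumberTheory.ComplexMultiplication

open Literature.NumberTheory.Automorphic

/-! ## §0 Colon calculus in the commutative semiring `Submodule ℤ Y` -/

section Colon

variable {t : Type} {L : t → Type} [∀ i, Field (L i)]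

/-- **`(A:B)(B:C) ⊆ (A:C)`** («`L_3:L_4 ⊃ (L_3:L_5)(L_5:L_6)(L_6:L_4)`»). [cite: HertlingLarabi2026, §5 Thm. 5.7 (proof of (c)), chunk p0013] -/
theorem div_mul_div_le_div (A B C : Submodule ℤ (Π i, L i)) : (A / B) * (B / C) ≤ A / C := by
  refine Submodule.mul_le.2 fun a ha b hb => Submodule.mem_div_iff_forall_mul_mem.2 fun c hc => ?_
  rw [mul_assoc]
  exact (Submodule.mem_div_iff_forall_mul_mem.1 ha) _ ((Submodule.mem_div_iff_forall_mul_mem.1 hb) c hc)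

/-- **`(L_1:L_2)(L_2:L_1) ⊆ L_1:L_1 = 𝒪(L_1)`** («By definition of quotient ideal we have that `(I:J)(J:I) ⊆ (I:I)`»).
[cite: Marseglia2019, §4 Prop. 4.1 (proof of (b) ⇒ (c)), chunk p0008] [cite: HertlingLarabi2026, §5 Thm. 5.7 (proof of (ii) ⇒ (iii)), chunk p0013] -/
theorem div_mul_div_le_div_self (M N : Submodule ℤ (Π i, L i)) : (M / N) * (N / M) ≤ M / M :=
  div_mul_div_le_div M N M

/-- **`𝒪(A)·(A:B) = (A:B)`** — the colon is an `𝒪(A)`-module («`(I:J)(J:I)` has a structure of both `(I:I)` and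
`(J:J)`-module»; HL (5.3) `𝒪(L_1:L_2) ⊃ Λ_1Λ_2`). [cite: Marseglia2019, §4 Prop. 4.1 (proof), chunk p0008] [cite: HertlingLarabi2026, §5 Lemma 5.3 (b), chunk p0011] -/
theorem div_self_mul_div_eq (A B : Submodule ℤ (Π i, L i)) : (A / A) * (A / B) = A / B := by
  refine le_antisymm (div_mul_div_le_div A A B) fun x hx => ?_
  rw [← one_mul x]
  exact Submodule.mul_mem_mul (one_mem_div_self A) hx

/-- **`(A:B)·𝒪(B) = (A:B)`** — the colon is an `𝒪(B)`-module. [cite: Marseglia2019, §4 Prop. 4.1 (proof), chunk p0008] [cite: HertlingLarabi2026, §5 Lemma 5.3 (b), chunk p0011] -/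
theorem div_mul_div_self_eq (A B : Submodule ℤ (Π i, L i)) : (A / B) * (B / B) = A / B := by
  refine le_antisymm (div_mul_div_le_div A B B) fun x hx => ?_
  rw [← mul_one x]
  exact Submodule.mul_mem_mul hx (one_mem_div_self B)

/-- `(L_2:L_1)·L_1 ⊆ L_2` (file-local spelling of the definition of the colon). [cite: HertlingLarabi2026, §5 Lemma 5.2 (a), chunk p0011] -/
private theorem div_mul_le (L₁ L₂ : Submodule ℤ (Π i, L i)) : (L₂ / L₁) * L₁ ≤ L₂ :=
  Submodule.le_div_iff_mul_le.1 le_rfl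

/-- **`L_1L_3 = L_2 ⟹ L_1·(L_2:L_1) = L_2`** («Especially `L_1(L_2:L_1) = L_2` … (and not just
`L_1(L_2:L_1) ⊂ L_2`)»). [cite: HertlingLarabi2026, §5 Thm. 5.7 (proof of (a) (i) ⇒ (ii)), chunk p0013] -/
theorem mul_div_eq_of_mul_eq {L₁ L₂ L₃ : Submodule ℤ (Π i, L i)} (h : L₁ * L₃ = L₂) : L₁ * (L₂ / L₁) = L₂ := by
  refine le_antisymm (by rw [mul_comm]; exact div_mul_le L₁ L₂) ?_
  have h3 : L₃ ≤ L₂ / L₁ := Submodule.le_div_iff_mul_le.2 (le_of_eq (by rw [mul_comm, h]))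
  calc L₂ = L₁ * L₃ := h.symm
    _ ≤ L₁ * (L₂ / L₁) := mul_le_mul_right h3 _

/-- **PROP. 4.1 (c) ⟹ (b), unit-free form: `I = AJ`, `J = BI` and `1 ∈ AB` imply `1 ∈ (I:J)(J:I)`** (`A ⊆ I:J`,
`B ⊆ J:I`). [cite: Marseglia2019, §4 Prop. 4.1 (c) ⇒ (b), chunk p0008] [cite: HertlingLarabi2026, §5 Thm. 5.7 (a) (iii) ⇒ (i), chunk p0013] -/
theorem one_mem_div_mul_div_of_eq_mul {I J A B : Submodule ℤ (Π i, L i)} (hI : A * J = I) (hJ : B * I = J)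
    (h1 : (1 : Π i, L i) ∈ A * B) : (1 : Π i, L i) ∈ (I / J) * (J / I) :=
  mul_le_mul' (Submodule.le_div_iff_mul_le.2 hI.le) (Submodule.le_div_iff_mul_le.2 hJ.le) h1

/-- `M/(uN) = u⁻¹(M/N)` (g31-#5's `units_smul_div_units_smul` with the first unit `1`).
[cite: HertlingLarabi2026, §5 Lemma 5.5 (proof), chunk p0012] -/
theorem div_units_smul (u : (Π i, L i)ˣ) (M N : Submodule ℤ (Π i, L i)) : M / (u • N) = u⁻¹ • (M / N) := by
  have h := units_smul_div_units_smul 1 u M N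
  rwa [one_smul, one_mul] at h

/-- **`G(Λ)` is a union of `ε`-classes: `uM` is invertible when `M` is** (with `𝒪(uM) = 𝒪(M)`,
`div_self_units_smul`), so `G(Λ)` descends to `G([Λ]_ε) = Pic(Λ)`. [cite: HertlingLarabi2026, §5 Thm. 5.6 (c) (iii) ⟺ (iv), chunk p0012] -/
theorem units_smul_mul_div_div_eq (u : (Π i, L i)ˣ) {M : Submodule ℤ (Π i, L i)}
    (h : M * ((M / M) / M) = M / M) : (u • M) * (((u • M) / (u • M)) / (u • M)) = (u • M) / (u • M) := by
  rw [div_self_units_smul, div_units_smul, units_smul_mul_units_smul, mul_inv_cancel, one_smul, h]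

/-! ## §1 Theorem 5.7 (a), (b): `L_1 ∼_w L_2` ⟺ `1 ∈ (L_1:L_2)(L_2:L_1)` ⟺ `L_2 = L_1L_3`, `L_3 ∈ G(𝒪(L_1))` -/

/-- **THEOREM 5.7 (b) ∕ PROP. 4.1 (b) ⇒ (c): `1 ∈ (L_1:L_2)(L_2:L_1)` ⟹ `(L_1:L_2)(L_2:L_1) = 𝒪(L_1)`** («Since
`(I:J)(J:I)` has a structure of … `(I:I)`-module and contains `1`»; no fullness hypothesis).
[cite: HertlingLarabi2026, §5 Thm. 5.7 (b), chunk p0013] [cite: Marseglia2019, §4 Prop. 4.1 (b) ⇒ (c), chunk p0008] -/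
theorem div_mul_div_eq_div_self_of_one_mem {L₁ L₂ : Submodule ℤ (Π i, L i)}
    (h : (1 : Π i, L i) ∈ (L₁ / L₂) * (L₂ / L₁)) : (L₁ / L₂) * (L₂ / L₁) = L₁ / L₁ := by
  refine le_antisymm (div_mul_div_le_div_self L₁ L₂) fun x hx => ?_
  have hx1 : x * 1 ∈ (L₁ / L₁) * ((L₁ / L₂) * (L₂ / L₁)) := Submodule.mul_mem_mul hx h
  rwa [mul_one, ← mul_assoc, div_self_mul_div_eq] at hx1

/-- **THEOREM 5.7 (a)(b) ∕ PROP. 4.1 (b) ⇒ (c): weakly equivalent lattices have THE SAME ORDER, `𝒪(L_1) = 𝒪(L_2)`**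
(«`(I:I) = (I:J)(J:I) = (J:J)`»). [cite: HertlingLarabi2026, §5 Thm. 5.7 (a) (ii) ⇒ (iii), chunk p0013] [cite: Marseglia2019, §4 Prop. 4.1 (b) ⇒ (c), chunk p0008] -/
theorem div_self_eq_div_self_of_one_mem {L₁ L₂ : Submodule ℤ (Π i, L i)}
    (h : (1 : Π i, L i) ∈ (L₁ / L₂) * (L₂ / L₁)) : L₁ / L₁ = L₂ / L₂ := by
  have h' : (1 : Π i, L i) ∈ (L₂ / L₁) * (L₁ / L₂) := by rwa [mul_comm]
  rw [← div_mul_div_eq_div_self_of_one_mem h, mul_comm, div_mul_div_eq_div_self_of_one_mem h']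

/-- **THEOREM 5.7 (b) ∕ COROLLARY 4.5: `1 ∈ (L_1:L_2)(L_2:L_1)` ⟹ `(L_2:L_1)·L_1 = L_2`** («`I = (I:J)J`»;
«`L_2 = L_2Λ ⊂ L_1(L_2:L_1) ⊂ L_2`»). [cite: HertlingLarabi2026, §5 Thm. 5.7 (b), chunk p0013] [cite: Marseglia2019, §4 Cor. 4.5, chunk p0008] -/
theorem div_mul_eq_of_one_mem {L₁ L₂ : Submodule ℤ (Π i, L i)}
    (h : (1 : Π i, L i) ∈ (L₁ / L₂) * (L₂ / L₁)) : (L₂ / L₁) * L₁ = L₂ := by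
  refine le_antisymm (div_mul_le L₁ L₂) ?_
  have h' : (1 : Π i, L i) ∈ (L₂ / L₁) * (L₁ / L₂) := by rwa [mul_comm]
  calc L₂ = (L₂ / L₂) * L₂ := (div_self_mul_self L₂).symm
    _ = (L₂ / L₁) * ((L₁ / L₂) * L₂) := by rw [← div_mul_div_eq_div_self_of_one_mem h', mul_assoc]
    _ ≤ (L₂ / L₁) * L₁ := mul_le_mul_right (div_mul_le L₂ L₁) _

/-- **THEOREM 5.7 (b): `𝒪(L_1:L_2) = 𝒪(L_1)`** under `1 ∈ (L_1:L_2)(L_2:L_1)` («`𝒪(L_1) ⊂ 𝒪(L_1:L_2) ⊂ 𝒪(Λ) = Λ`»).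
[cite: HertlingLarabi2026, §5 Thm. 5.7 (b), chunk p0013] -/
theorem div_self_div_eq_div_self_of_one_mem {L₁ L₂ : Submodule ℤ (Π i, L i)}
    (h : (1 : Π i, L i) ∈ (L₁ / L₂) * (L₂ / L₁)) : (L₁ / L₂) / (L₁ / L₂) = L₁ / L₁ := by
  refine le_antisymm (fun x hx => ?_) (Submodule.le_div_iff_mul_le.2 (div_self_mul_div_eq L₁ L₂).le)
  -- `x(L_1:L_2) ⊆ L_1:L_2` gives `xΛ ⊆ Λ` for `Λ = (L_1:L_2)(L_2:L_1) = 𝒪(L_1)`, and `𝒪(𝒪(L_1)) = 𝒪(L_1)`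
  have hx' : x ∈ ((L₁ / L₂) * (L₂ / L₁)) / ((L₁ / L₂) * (L₂ / L₁)) :=
    Submodule.mem_div_iff_forall_mul_mem.2 fun y hy =>
      Submodule.mul_induction_on hy (fun a ha b hb => by
          rw [← mul_assoc]
          exact Submodule.mul_mem_mul ((Submodule.mem_div_iff_forall_mul_mem.1 hx) a ha) hb)
        (fun a b ha hb => by rw [mul_add]; exact Submodule.add_mem _ ha hb)
  rwa [div_mul_div_eq_div_self_of_one_mem h, div_self_div_div_self] at hx'

/-- **THEOREM 5.7 (b): `L_1:L_2 ∈ G(𝒪(L_1))` — the colon of weakly equivalent lattices is INVERTIBLE**,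
`(L_1:L_2)·(𝒪(L_1:L_2):(L_1:L_2)) = 𝒪(L_1:L_2)` («`(I:J)` is a fractional ideal invertible in `S`»).
[cite: HertlingLarabi2026, §5 Thm. 5.7 (b), chunk p0013] [cite: Marseglia2019, §4 Cor. 4.5, chunk p0008] -/
theorem div_mul_inv_eq_of_one_mem {L₁ L₂ : Submodule ℤ (Π i, L i)}
    (h : (1 : Π i, L i) ∈ (L₁ / L₂) * (L₂ / L₁)) :
    (L₁ / L₂) * (((L₁ / L₂) / (L₁ / L₂)) / (L₁ / L₂)) = (L₁ / L₂) / (L₁ / L₂) :=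
  mul_div_div_eq_of_exists_mul_eq ⟨L₂ / L₁, by
    rw [div_mul_div_eq_div_self_of_one_mem h, div_self_div_eq_div_self_of_one_mem h]⟩

/-- **THEOREM 5.7 (b): `(L_1:L_2)⁻¹ = L_2:L_1`**, i.e. `𝒪(L_1):(L_1:L_2) = L_2:L_1` («`(I:J)` and `(J:I)` are inverse
to each other»). [cite: HertlingLarabi2026, §5 Thm. 5.7 (b), chunk p0013] [cite: Marseglia2019, §4 Prop. 4.1 (proof), chunk p0008] -/
theorem div_self_div_div_eq_of_one_mem {L₁ L₂ : Submodule ℤ (Π i, L i)}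
    (h : (1 : Π i, L i) ∈ (L₁ / L₂) * (L₂ / L₁)) : (L₁ / L₁) / (L₁ / L₂) = L₂ / L₁ := by
  have hO := div_self_div_eq_div_self_of_one_mem h
  have h1 : (L₁ / L₂) * (L₂ / L₁) = (L₁ / L₂) / (L₁ / L₂) := by
    rw [hO]; exact div_mul_div_eq_div_self_of_one_mem h
  have h2 : ((L₁ / L₂) / (L₁ / L₂)) * (L₂ / L₁) = L₂ / L₁ := by
    rw [hO, div_self_eq_div_self_of_one_mem h]; exact div_self_mul_div_eq L₂ L₁
  have h3 := eq_div_div_of_mul_eq_div_self h1 h2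
  rw [hO] at h3
  exact h3.symm

/-- **THEOREM 5.7 (a) (iii) ⟹ (ii), unit-free: if `𝒪(L_3) = 𝒪(L_1)`, `L_3` is invertible and `L_1L_3 = L_2`, then
`1 ∈ (L_1:L_2)(L_2:L_1)`** — `L_2 = L_3L_1`, `L_1 = L_1𝒪(L_1) = L_1L_3L_3⁻¹ = L_3⁻¹L_2` and `1 ∈ L_3L_3⁻¹`; no
fullness hypothesis. [cite: HertlingLarabi2026, §5 Thm. 5.7 (a) (iii) ⇒ (i), chunk p0013] [cite: Marseglia2019, §4 Prop. 4.1 (c) ⇒ (b), chunk p0008] -/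
theorem one_mem_div_mul_div_of_invertible_mul_eq {L₁ L₂ L₃ : Submodule ℤ (Π i, L i)} (hO : L₃ / L₃ = L₁ / L₁)
    (hinv : L₃ * ((L₃ / L₃) / L₃) = L₃ / L₃) (h : L₁ * L₃ = L₂) :
    (1 : Π i, L i) ∈ (L₁ / L₂) * (L₂ / L₁) := by
  have h' : (1 : Π i, L i) ∈ (L₂ / L₁) * (L₁ / L₂) := by
    refine one_mem_div_mul_div_of_eq_mul (A := L₃) (B := (L₃ / L₃) / L₃) (by rw [mul_comm, h]) ?_
      (by rw [hinv]; exact one_mem_div_self L₃)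
    rw [← h, mul_comm L₁ L₃, ← mul_assoc, mul_comm ((L₃ / L₃) / L₃) L₃, hinv, hO, div_self_mul_self]
  rwa [mul_comm] at h'

end Colon

section Krull

variable {t : Type} {L : t → Type} [∀ i, Field (L i)] [∀ i, NumberField (L i)]

/-- **THEOREM 5.7 (a) (i) ⟹ (ii) [DTZ62]: `L_1L_3 = L_2` and `L_2L_4 = L_1` for a FULL lattice `L_2` imply
`1 ∈ (L_1:L_2)(L_2:L_1)`** — Krull's lemma (g31-#5 `one_mem_of_mul_le_of_mul_eq`) for `Λ = (L_1:L_2)(L_2:L_1)`: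
«`L_2(L_1:L_2)(L_2:L_1) = L_1(L_2:L_1) = L_2`, `((L_1:L_2)(L_2:L_1))² ⊂ (L_1:L_2)(L_2:L_1)(L_1:L_1) = (L_1:L_2)(L_2:L_1)`».
[cite: HertlingLarabi2026, §5 Thm. 5.7 (a) (i) ⇒ (ii), chunk p0013] [cite: DadeTausskyZassenhaus1962, §1] -/
theorem one_mem_div_mul_div_of_mul_eq_of_mul_eq {L₁ L₂ L₃ L₄ : Submodule ℤ (Π i, L i)}
    (hL₂ : IsFullLattice (Π i, L i) L₂) (h₃ : L₁ * L₃ = L₂) (h₄ : L₂ * L₄ = L₁) :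
    (1 : Π i, L i) ∈ (L₁ / L₂) * (L₂ / L₁) := by
  have hA : L₁ * (L₂ / L₁) = L₂ := mul_div_eq_of_mul_eq h₃
  have hB : L₂ * (L₁ / L₂) = L₁ := mul_div_eq_of_mul_eq h₄
  refine one_mem_of_mul_le_of_mul_eq (Λ := (L₁ / L₂) * (L₂ / L₁)) ?_ hL₂ ?_
  · calc (L₁ / L₂) * (L₂ / L₁) * ((L₁ / L₂) * (L₂ / L₁))
          ≤ (L₁ / L₂) * (L₂ / L₁) * (L₁ / L₁) := mul_le_mul_right (div_mul_div_le_div_self L₁ L₂) _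
      _ = (L₁ / L₂) * ((L₂ / L₁) * (L₁ / L₁)) := mul_assoc _ _ _
      _ = (L₁ / L₂) * (L₂ / L₁) := by rw [div_mul_div_self_eq]
  · calc (L₁ / L₂) * (L₂ / L₁) * L₂ = (L₂ / L₁) * (L₂ * (L₁ / L₂)) := by
          rw [mul_comm (L₁ / L₂) (L₂ / L₁), mul_assoc, mul_comm (L₁ / L₂) L₂]
      _ = L₂ := by rw [hB, mul_comm, hA]

/-- **THEOREM 5.7 (a) (i) ⟺ (ii) [DTZ62] ∕ DEF. 4.3 (b) in `𝓛(Y)`: for FULL lattices, `L_1 ∼_w L_2` — full `L_3`,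
`L_4` with `L_1L_3 = L_2`, `L_2L_4 = L_1` exist (the clause «`a_1 = a_2`» of Def. 4.3 (b) is the case
`L_3 = L_4 = 𝒪(L_1)`) — iff `1 ∈ (L_1:L_2)(L_2:L_1)`**; then `L_3 = L_2:L_1`, `L_4 = L_1:L_2` serve.
[cite: HertlingLarabi2026, §5 Thm. 5.7 (a) (i) ⟺ (ii) and §4 Def. 4.3 (b), chunks p0013, p0009] [cite: Marseglia2019, §4 Prop. 4.1, Def. 4.2, chunk p0008] -/
theorem one_mem_div_mul_div_iff_exists_mul_eq {L₁ L₂ : Submodule ℤ (Π i, L i)}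
    (hL₁ : IsFullLattice (Π i, L i) L₁) (hL₂ : IsFullLattice (Π i, L i) L₂) :
    (1 : Π i, L i) ∈ (L₁ / L₂) * (L₂ / L₁) ↔
      ∃ L₃ L₄ : Submodule ℤ (Π i, L i), IsFullLattice (Π i, L i) L₃ ∧ IsFullLattice (Π i, L i) L₄ ∧
        L₁ * L₃ = L₂ ∧ L₂ * L₄ = L₁ := by
  refine ⟨fun h => ⟨L₂ / L₁, L₁ / L₂, isFullLattice_div hL₂ hL₁, isFullLattice_div hL₁ hL₂, ?_, ?_⟩,
    fun ⟨L₃, L₄, _, _, h₃, h₄⟩ => one_mem_div_mul_div_of_mul_eq_of_mul_eq hL₂ h₃ h₄⟩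
  · rw [mul_comm]; exact div_mul_eq_of_one_mem h
  · have h' : (1 : Π i, L i) ∈ (L₂ / L₁) * (L₁ / L₂) := by rwa [mul_comm]
    rw [mul_comm]; exact div_mul_eq_of_one_mem h'

omit [∀ i, NumberField (L i)] in
/-- **THEOREM 5.7 (a) (ii) ⟺ (iii) ∕ PROP. 4.1 (b) ⟺ (c): `1 ∈ (L_1:L_2)(L_2:L_1)` iff `𝒪(L_1) = 𝒪(L_2)` and
`L_2 = L_1L_3` for an INVERTIBLE `L_3` with `𝒪(L_3) = 𝒪(L_1)`** (`L_3 = L_2:L_1`; no fullness hypothesis either way).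
[cite: HertlingLarabi2026, §5 Thm. 5.7 (a) (ii) ⟺ (iii), chunk p0013] [cite: Marseglia2019, §4 Prop. 4.1 (b) ⟺ (c), chunk p0008] -/
theorem one_mem_div_mul_div_iff_exists_invertible_mul_eq (L₁ L₂ : Submodule ℤ (Π i, L i)) :
    (1 : Π i, L i) ∈ (L₁ / L₂) * (L₂ / L₁) ↔
      L₁ / L₁ = L₂ / L₂ ∧ ∃ L₃ : Submodule ℤ (Π i, L i),
        L₃ / L₃ = L₁ / L₁ ∧ L₃ * ((L₃ / L₃) / L₃) = L₃ / L₃ ∧ L₁ * L₃ = L₂ := by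
  refine ⟨fun h => ⟨div_self_eq_div_self_of_one_mem h, L₂ / L₁, ?_, ?_, ?_⟩,
    fun ⟨_, L₃, hO, hinv, h⟩ => one_mem_div_mul_div_of_invertible_mul_eq hO hinv h⟩
  · have h' : (1 : Π i, L i) ∈ (L₂ / L₁) * (L₁ / L₂) := by rwa [mul_comm]
    rw [div_self_div_eq_div_self_of_one_mem h', div_self_eq_div_self_of_one_mem h]
  · have h' : (1 : Π i, L i) ∈ (L₂ / L₁) * (L₁ / L₂) := by rwa [mul_comm]
    exact div_mul_inv_eq_of_one_mem h'
  · rw [mul_comm]; exact div_mul_eq_of_one_mem h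

omit [∀ i, NumberField (L i)] in
/-- **THEOREM 5.7 (a) (iv) ⟺ (i): `[L_1]_ε ∼_w [L_2]_ε` in `𝓔(Y)` — `a_1(L_1L_3) = L_2`, `a_2(L_2L_4) = L_1` for units
`a_1, a_2` — iff `L_1 ∼_w L_2` in `𝓛(Y)`** (absorb the units: `a(L_1L_3) = L_1(aL_3)`).
[cite: HertlingLarabi2026, §5 Thm. 5.7 (a) (i) ⟺ (iv), chunk p0013] -/
theorem exists_units_smul_mul_eq_iff_exists_mul_eq (L₁ L₂ : Submodule ℤ (Π i, L i)) :
    (∃ (L₃ L₄ : Submodule ℤ (Π i, L i)) (a₁ a₂ : (Π i, L i)ˣ), IsFullLattice (Π i, L i) L₃ ∧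
        IsFullLattice (Π i, L i) L₄ ∧ a₁ • (L₁ * L₃) = L₂ ∧ a₂ • (L₂ * L₄) = L₁) ↔
      ∃ L₃ L₄ : Submodule ℤ (Π i, L i), IsFullLattice (Π i, L i) L₃ ∧ IsFullLattice (Π i, L i) L₄ ∧
        L₁ * L₃ = L₂ ∧ L₂ * L₄ = L₁ := by
  constructor
  · rintro ⟨L₃, L₄, a₁, a₂, hL₃, hL₄, h₃, h₄⟩
    refine ⟨a₁ • L₃, a₂ • L₄, isFullLattice_units_smul a₁ hL₃, isFullLattice_units_smul a₂ hL₄, ?_, ?_⟩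
    · rw [mul_comm, ← units_smul_mul, mul_comm, h₃]
    · rw [mul_comm, ← units_smul_mul, mul_comm, h₄]
  · rintro ⟨L₃, L₄, hL₃, hL₄, h₃, h₄⟩
    exact ⟨L₃, L₄, 1, 1, hL₃, hL₄, by rw [one_smul, h₃], by rw [one_smul, h₄]⟩

/-! ## §2 Theorem 4.4 (a) in `𝓛(Y)` and Theorem 5.7 (c): `∼_w` is a congruence; `W(𝓛(Y)) = W(𝓔(Y))`; division -/

omit [∀ i, NumberField (L i)] in
/-- `∼_w` is REFLEXIVE: `1 = 1·1 ∈ 𝒪(L)𝒪(L)`. [cite: HertlingLarabi2026, §4 Thm. 4.4 (a), chunk p0009] -/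
theorem one_mem_div_self_mul_div_self (M : Submodule ℤ (Π i, L i)) : (1 : Π i, L i) ∈ (M / M) * (M / M) := by
  rw [← one_mul (1 : Π i, L i)]
  exact Submodule.mul_mem_mul (one_mem_div_self M) (one_mem_div_self M)

omit [∀ i, NumberField (L i)] in
/-- `∼_w` is SYMMETRIC (commutativity of `𝓛(Y)`). [cite: HertlingLarabi2026, §4 Thm. 4.4 (a), chunk p0009] -/
theorem one_mem_div_mul_div_comm (M N : Submodule ℤ (Π i, L i)) :
    (1 : Π i, L i) ∈ (M / N) * (N / M) ↔ (1 : Π i, L i) ∈ (N / M) * (M / N) := by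
  rw [mul_comm]

omit [∀ i, NumberField (L i)] in
/-- `∼_w` is TRANSITIVE: `1 = 1·1 ∈ ((A:B)(B:C))·((C:B)(B:A)) ⊆ (A:C)(C:A)`. [cite: HertlingLarabi2026, §4 Thm. 4.4 (a), chunk p0009] [cite: Marseglia2019, §4 Def. 4.2 (`Wk(R)`), chunk p0008] -/
theorem one_mem_div_mul_div_trans {A B C : Submodule ℤ (Π i, L i)} (hAB : (1 : Π i, L i) ∈ (A / B) * (B / A))
    (hBC : (1 : Π i, L i) ∈ (B / C) * (C / B)) : (1 : Π i, L i) ∈ (A / C) * (C / A) := by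
  have h1 : (1 : Π i, L i) * 1 ∈ ((A / B) * (B / A)) * ((B / C) * (C / B)) := Submodule.mul_mem_mul hAB hBC
  rw [mul_one, mul_mul_mul_comm, mul_comm (B / A) (C / B)] at h1
  exact mul_le_mul' (div_mul_div_le_div A B C) (div_mul_div_le_div C B A) h1

omit [∀ i, NumberField (L i)] in
/-- **THEOREM 4.4 (a): weak equivalence is an EQUIVALENCE RELATION** on every family `{M | p M}` of lattices of `Y`
(the quotient is `W(𝓛(Y))`; on a stratum `𝒪(M) = S` it is Marseglia's `W̄k(S)`).
[cite: HertlingLarabi2026, §4 Thm. 4.4 (a), chunk p0009] [cite: Marseglia2019, §4 Def. 4.2, chunk p0008] -/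
theorem equivalence_one_mem_div_mul_div (p : Submodule ℤ (Π i, L i) → Prop) :
    Equivalence fun M N : {M : Submodule ℤ (Π i, L i) // p M} =>
      (1 : Π i, L i) ∈ ((M : Submodule ℤ (Π i, L i)) / N) * ((N : Submodule ℤ (Π i, L i)) / M) where
  refl M := one_mem_div_self_mul_div_self M.1
  symm h := (one_mem_div_mul_div_comm _ _).1 h
  trans h₁ h₂ := one_mem_div_mul_div_trans h₁ h₂

omit [∀ i, NumberField (L i)] in
/-- **THEOREM 4.4 (a) (4.5): `∼_w` is COMPATIBLE WITH THE PRODUCT — `A_1 ∼_w A_2`, `B_1 ∼_w B_2 ⟹ A_1B_1 ∼_w A_2B_2`**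
(`(A_1:A_2)(B_1:B_2) ⊆ (A_1B_1):(A_2B_2)`, g31-#5 `div_mul_div_le`), so `W(𝓛(Y))` is a commutative semigroup
(«`Wk(R)` inherits the structure of a commutative monoid»). [cite: HertlingLarabi2026, §4 Thm. 4.4 (a) (4.5), chunk p0009] [cite: Marseglia2019, §4 (after Def. 4.2), chunk p0008] -/
theorem one_mem_div_mul_div_mul {A₁ A₂ B₁ B₂ : Submodule ℤ (Π i, L i)}
    (hA : (1 : Π i, L i) ∈ (A₁ / A₂) * (A₂ / A₁)) (hB : (1 : Π i, L i) ∈ (B₁ / B₂) * (B₂ / B₁)) :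
    (1 : Π i, L i) ∈ ((A₁ * B₁) / (A₂ * B₂)) * ((A₂ * B₂) / (A₁ * B₁)) := by
  have h1 : (1 : Π i, L i) * 1 ∈ ((A₁ / A₂) * (A₂ / A₁)) * ((B₁ / B₂) * (B₂ / B₁)) := Submodule.mul_mem_mul hA hB
  rw [mul_one, mul_mul_mul_comm] at h1
  exact mul_le_mul' (div_mul_div_le A₁ A₂ B₁ B₂) (div_mul_div_le A₂ A₁ B₂ B₁) h1

omit [∀ i, NumberField (L i)] in
/-- **THEOREM 5.7 (c), `W(𝓛(Y)) = W(𝓔(Y))`: `ε`-equivalent lattices are weakly equivalent — `uL_1 = L_2 ⟹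
1 = u⁻¹·u ∈ (L_1:L_2)(L_2:L_1)`** («`L_1a𝒪(L_1) = L_2` and `L_2a⁻¹𝒪(L_1) = L_1`, so `L_1 ∼_w L_2`»; «being weakly
equivalent is a necessary condition for being isomorphic»). [cite: HertlingLarabi2026, §5 Thm. 5.7 (c), chunk p0013] [cite: Marseglia2019, §4 (before Cor. 4.5), chunk p0008] -/
theorem one_mem_div_mul_div_of_units_smul_eq {L₁ L₂ : Submodule ℤ (Π i, L i)} {u : (Π i, L i)ˣ}
    (h : u • L₁ = L₂) : (1 : Π i, L i) ∈ (L₁ / L₂) * (L₂ / L₁) := by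
  have h1 : ((u⁻¹ : (Π i, L i)ˣ) : Π i, L i) ∈ L₁ / L₂ := Submodule.mem_div_iff_forall_mul_mem.2 fun y hy => by
    rw [← h, mem_units_smul_submodule_iff] at hy
    rwa [Units.smul_def, smul_eq_mul] at hy
  have h2 : ((u : (Π i, L i)ˣ) : Π i, L i) ∈ L₂ / L₁ := Submodule.mem_div_iff_forall_mul_mem.2 fun y hy => by
    rw [← h, mem_units_smul_submodule_iff, Units.smul_def, smul_eq_mul, ← mul_assoc, Units.inv_mul, one_mul]
    exact hy
  have h3 := Submodule.mul_mem_mul h1 h2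
  rwa [Units.inv_mul] at h3

omit [∀ i, NumberField (L i)] in
/-- **THEOREM 5.7 (c) (5.9), explicit form: `L_3 ∼_w L_5`, `L_4 ∼_w L_6 ⟹ L_3:L_4 = (L_5:L_6)·((L_3:L_5)(L_6:L_4))`**
(«`L_3:L_4 ⊃ (L_3:L_5)(L_5:L_6)(L_6:L_4) ⊃ (L_3:L_5)(L_5:L_3)(L_3:L_4)(L_4:L_6)(L_6:L_4) = 𝒪(L_3)(L_3:L_4)𝒪(L_4) =
(L_3:L_4)`»). [cite: HertlingLarabi2026, §5 Thm. 5.7 (c) (proof of (5.9)), chunk p0013] -/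
theorem div_eq_div_mul_of_one_mem_of_one_mem {L₃ L₄ L₅ L₆ : Submodule ℤ (Π i, L i)}
    (h₃₅ : (1 : Π i, L i) ∈ (L₃ / L₅) * (L₅ / L₃)) (h₄₆ : (1 : Π i, L i) ∈ (L₄ / L₆) * (L₆ / L₄)) :
    L₃ / L₄ = (L₅ / L₆) * ((L₃ / L₅) * (L₆ / L₄)) := by
  have h₆₄ : (1 : Π i, L i) ∈ (L₆ / L₄) * (L₄ / L₆) := by rwa [mul_comm]
  have hup : (L₅ / L₆) * ((L₃ / L₅) * (L₆ / L₄)) ≤ L₃ / L₄ :=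
    calc (L₅ / L₆) * ((L₃ / L₅) * (L₆ / L₄)) = ((L₃ / L₅) * (L₅ / L₆)) * (L₆ / L₄) := by
          rw [mul_left_comm, mul_assoc]
      _ ≤ (L₃ / L₆) * (L₆ / L₄) := mul_le_mul_left (div_mul_div_le_div L₃ L₅ L₆) _
      _ ≤ L₃ / L₄ := div_mul_div_le_div L₃ L₆ L₄
  refine le_antisymm ?_ hup
  -- `L_3:L_4 = 𝒪(L_3)(L_3:L_4)𝒪(L_4) = (L_3:L_5)(L_5:L_3)(L_3:L_4)(L_4:L_6)(L_6:L_4) ⊆ (L_5:L_6)((L_3:L_5)(L_6:L_4))`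
  calc L₃ / L₄ = (L₃ / L₃) * (L₃ / L₄) * (L₄ / L₄) := by rw [div_self_mul_div_eq, div_mul_div_self_eq]
    _ = ((L₃ / L₅) * (L₅ / L₃)) * (L₃ / L₄) * ((L₄ / L₆) * (L₆ / L₄)) := by
        rw [div_mul_div_eq_div_self_of_one_mem h₃₅, div_mul_div_eq_div_self_of_one_mem h₄₆]
    _ = ((L₅ / L₃) * (L₃ / L₄) * (L₄ / L₆)) * ((L₃ / L₅) * (L₆ / L₄)) := by ring
    _ ≤ (L₅ / L₆) * ((L₃ / L₅) * (L₆ / L₄)) := by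
        refine mul_le_mul_left ?_ _
        calc (L₅ / L₃) * (L₃ / L₄) * (L₄ / L₆) ≤ (L₅ / L₄) * (L₄ / L₆) :=
              mul_le_mul_left (div_mul_div_le_div L₅ L₃ L₄) _
          _ ≤ L₅ / L₆ := div_mul_div_le_div L₅ L₄ L₆

omit [∀ i, NumberField (L i)] in
/-- **THEOREM 5.7 (c) (5.9): `∼_w` is COMPATIBLE WITH THE DIVISION MAP — `L_3 ∼_w L_5`, `L_4 ∼_w L_6 ⟹
L_3:L_4 ∼_w L_5:L_6`** («this semigroup inherits a division map from the division map on `𝓛(A)`»; with the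
multipliers `(L_3:L_5)(L_6:L_4)` and `(L_5:L_3)(L_4:L_6)`, whose product is `𝒪(L_3)𝒪(L_4) ∋ 1`).
[cite: HertlingLarabi2026, §5 Thm. 5.7 (c) (5.9), chunk p0013] -/
theorem one_mem_div_div_mul_div_div {L₃ L₄ L₅ L₆ : Submodule ℤ (Π i, L i)}
    (h₃₅ : (1 : Π i, L i) ∈ (L₃ / L₅) * (L₅ / L₃)) (h₄₆ : (1 : Π i, L i) ∈ (L₄ / L₆) * (L₆ / L₄)) :
    (1 : Π i, L i) ∈ ((L₃ / L₄) / (L₅ / L₆)) * ((L₅ / L₆) / (L₃ / L₄)) := by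
  have h₅₃ : (1 : Π i, L i) ∈ (L₅ / L₃) * (L₃ / L₅) := by rwa [mul_comm]
  have h₆₄ : (1 : Π i, L i) ∈ (L₆ / L₄) * (L₄ / L₆) := by rwa [mul_comm]
  refine one_mem_div_mul_div_of_eq_mul (A := (L₃ / L₅) * (L₆ / L₄)) (B := (L₅ / L₃) * (L₄ / L₆)) ?_ ?_ ?_
  · rw [mul_comm]; exact (div_eq_div_mul_of_one_mem_of_one_mem h₃₅ h₄₆).symm
  · rw [mul_comm]; exact (div_eq_div_mul_of_one_mem_of_one_mem h₅₃ h₆₄).symm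
  · have h1 : (1 : Π i, L i) * 1 ∈ ((L₃ / L₅) * (L₅ / L₃)) * ((L₆ / L₄) * (L₄ / L₆)) :=
      Submodule.mul_mem_mul h₃₅ h₆₄
    rwa [mul_one, mul_mul_mul_comm] at h1

/-! ## §3 Theorem 5.8 (a), (b) and Theorem 4.4 (b), (c): uniqueness, `G(Λ) = [Λ]_w`, the bijection `L_3 ↦ L_3L_1` -/

omit [∀ i, NumberField (L i)] in
/-- **THEOREM 5.8 (a), UNIQUENESS: if `𝒪(L_3) = 𝒪(L_1)`, `L_3` is invertible and `L_1L_3 = L_2`, then `L_3 = L_2:L_1`**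
(«`L_3 ⊂ L_2:L_1`. Also `L_1 = L_2L_3⁻¹` which implies `L_3⁻¹ ⊂ L_1:L_2`. This last inclusion implies
`L_3 ⊃ (L_1:L_2)⁻¹ = L_2:L_1`», with g31-#9's `(L_3⁻¹)⁻¹ = L_3`; no fullness hypothesis).
[cite: HertlingLarabi2026, §5 Thm. 5.8 (a), chunk p0013] -/
theorem eq_div_of_invertible_mul_eq {L₁ L₂ L₃ : Submodule ℤ (Π i, L i)} (hO : L₃ / L₃ = L₁ / L₁)
    (hinv : L₃ * ((L₃ / L₃) / L₃) = L₃ / L₃) (h : L₁ * L₃ = L₂) : L₃ = L₂ / L₁ := by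
  have hw : (1 : Π i, L i) ∈ (L₁ / L₂) * (L₂ / L₁) := one_mem_div_mul_div_of_invertible_mul_eq hO hinv h
  refine le_antisymm (Submodule.le_div_iff_mul_le.2 (le_of_eq (by rw [mul_comm, h]))) ?_
  -- `L_3⁻¹ ⊆ L_1:L_2`
  have hinvle : (L₃ / L₃) / L₃ ≤ L₁ / L₂ := Submodule.le_div_iff_mul_le.2 (le_of_eq (by
    rw [← h, mul_comm L₁ L₃, ← mul_assoc, mul_comm ((L₃ / L₃) / L₃) L₃, hinv, hO, div_self_mul_self]))
  -- `L_2:L_1 = 𝒪(L_1):(L_1:L_2) ⊆ 𝒪(L_3):L_3⁻¹ = L_3`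
  rw [← div_self_div_div_eq_of_one_mem hw, ← hO]
  calc (L₃ / L₃) / (L₁ / L₂) ≤ (L₃ / L₃) / ((L₃ / L₃) / L₃) := fun x hx =>
        Submodule.mem_div_iff_forall_mul_mem.2 fun y hy => (Submodule.mem_div_iff_forall_mul_mem.1 hx) y (hinvle hy)
    _ = L₃ := div_div_div_eq_self_of_mul_div_eq hinv

omit [∀ i, NumberField (L i)] in
/-- **THEOREM 5.8 (b) (5.11) ∕ THEOREM 4.4 (b): `G(Λ) = [Λ]_w` — for an ORDER `Λ` (`1 ∈ Λ`, `ΛΛ ⊆ Λ`) a lattice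
`M` is weakly equivalent to `Λ` iff `𝒪(M) = Λ` and `M` is invertible** («an ideal is invertible if and only if it is
weakly equivalent to its multiplicator ring»; no fullness hypothesis). [cite: HertlingLarabi2026, §5 Thm. 5.8 (b) (5.11) and §4 Thm. 4.4 (b), chunks p0013, p0009]
[cite: Marseglia2019, §4 (after Def. 4.2), chunk p0008] -/
theorem one_mem_div_mul_div_order_iff {Λ M : Submodule ℤ (Π i, L i)} (h1 : (1 : Π i, L i) ∈ Λ)
    (hΛ : Λ * Λ ≤ Λ) :
    (1 : Π i, L i) ∈ (M / Λ) * (Λ / M) ↔ M / M = Λ ∧ M * ((M / M) / M) = M / M := by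
  have hΛO : Λ / Λ = Λ := div_self_eq_of_one_mem h1 hΛ
  constructor
  · intro h
    have hO : M / M = Λ := by rw [div_self_eq_div_self_of_one_mem h, hΛO]
    -- `M:Λ = M` as `𝒪(M) = Λ`
    have hMΛ : M / Λ = M := by
      refine le_antisymm (fun x hx => ?_) (Submodule.le_div_iff_mul_le.2 (le_of_eq ?_))
      · simpa using (Submodule.mem_div_iff_forall_mul_mem.1 hx) 1 h1
      · rw [← hO, mul_comm, div_self_mul_self]
    refine ⟨hO, ?_⟩
    have hinv := div_mul_inv_eq_of_one_mem h
    rwa [hMΛ] at hinv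
  · rintro ⟨hO, hinv⟩
    -- `Λ = M⁻¹M`, `M = ΛM… = M·Λ`: the unit-free criterion with `A = M⁻¹`, `B = M`
    refine one_mem_div_mul_div_of_eq_mul (A := M) (B := (M / M) / M) ?_ ?_ (by rw [hinv, hO]; exact h1)
    · rw [mul_comm, ← hO, div_self_mul_self]
    · rw [mul_comm, hinv, hO]

omit [∀ i, NumberField (L i)] in
/-- **THEOREM 4.4 (b): `[L_1]_w = G(𝒪(L_1))` for an INVERTIBLE `L_1`** — `L_2 ∼_w L_1` iff `𝒪(L_2) = 𝒪(L_1)` and `L_2`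
is invertible (through `L_1 ∼_w 𝒪(L_1)` and transitivity). [cite: HertlingLarabi2026, §4 Thm. 4.4 (b), chunks p0009–p0010] -/
theorem one_mem_div_mul_div_iff_of_invertible {L₁ L₂ : Submodule ℤ (Π i, L i)}
    (hinv : L₁ * ((L₁ / L₁) / L₁) = L₁ / L₁) :
    (1 : Π i, L i) ∈ (L₂ / L₁) * (L₁ / L₂) ↔ L₂ / L₂ = L₁ / L₁ ∧ L₂ * ((L₂ / L₂) / L₂) = L₂ / L₂ := by
  have h1O := one_mem_div_self L₁
  have hOO := (div_self_mul_div_self_eq L₁).le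
  have hL₁ : (1 : Π i, L i) ∈ (L₁ / (L₁ / L₁)) * ((L₁ / L₁) / L₁) :=
    (one_mem_div_mul_div_order_iff h1O hOO).2 ⟨rfl, hinv⟩
  rw [← one_mem_div_mul_div_order_iff (M := L₂) h1O hOO]
  exact ⟨fun h => one_mem_div_mul_div_trans h hL₁,
    fun h => one_mem_div_mul_div_trans h ((one_mem_div_mul_div_comm _ _).1 hL₁)⟩

omit [∀ i, NumberField (L i)] in
/-- **THEOREM 5.8 (b) (5.12): the map `G(𝒪(L_1)) → [L_1]_w`, `L_3 ↦ L_3L_1`, is a BIJECTION — `L_2 ∼_w L_1` iff there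
is a UNIQUE invertible `L_3` with `𝒪(L_3) = 𝒪(L_1)` and `L_3L_1 = L_2`** (well defined: (iii) ⟹ (ii); surjective:
(ii) ⟹ (iii); injective: Thm. 5.8 (a); no fullness hypothesis). [cite: HertlingLarabi2026, §5 Thm. 5.8 (b) (5.12), chunks p0013–p0014] -/
theorem one_mem_div_mul_div_iff_existsUnique (L₁ L₂ : Submodule ℤ (Π i, L i)) :
    (1 : Π i, L i) ∈ (L₂ / L₁) * (L₁ / L₂) ↔
      ∃! L₃ : Submodule ℤ (Π i, L i),
        (L₃ / L₃ = L₁ / L₁ ∧ L₃ * ((L₃ / L₃) / L₃) = L₃ / L₃) ∧ L₃ * L₁ = L₂ := by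
  rw [one_mem_div_mul_div_comm, one_mem_div_mul_div_iff_exists_invertible_mul_eq]
  constructor
  · rintro ⟨-, L₃, hO, hinv, h⟩
    refine ⟨L₃, ⟨⟨hO, hinv⟩, by rw [mul_comm, h]⟩, fun L₃' ⟨⟨hO', hinv'⟩, h'⟩ => ?_⟩
    exact (eq_div_of_invertible_mul_eq hO' hinv' (by rw [mul_comm, h'])).trans
      (eq_div_of_invertible_mul_eq hO hinv h).symm
  · rintro ⟨L₃, ⟨⟨hO, hinv⟩, h⟩, -⟩
    have h' : L₁ * L₃ = L₂ := by rw [mul_comm, h]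
    exact ⟨div_self_eq_div_self_of_one_mem (one_mem_div_mul_div_of_invertible_mul_eq hO hinv h'), L₃, hO, hinv, h'⟩

/-- **THEOREM 4.4 (c) (i) ⟺ (iii) in `𝓛(Y)`: a full lattice `L` is INVERTIBLE iff its weak class is IDEMPOTENT,
`LL ∼_w L`** (⟸: with `X = L:(LL)`, `E = LX` is a full idempotent with `LE = L`, `L(LXX) = E`, so `E = 𝒪(L)` by
g31-#5's `idempotent_eq_div_self` — HL's «`a(bx_1y_1) = cy_1` and `(cy_1)a = a`»; ⟹: `LL = L·L`, `L = L⁻¹·LL`,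
`1 ∈ LL⁻¹`). [cite: HertlingLarabi2026, §4 Thm. 4.4 (c), chunks p0009–p0010] -/
theorem one_mem_div_mul_self_mul_div_iff {M : Submodule ℤ (Π i, L i)} (hM : IsFullLattice (Π i, L i) M) :
    (1 : Π i, L i) ∈ (M / (M * M)) * ((M * M) / M) ↔ M * ((M / M) / M) = M / M := by
  constructor
  · intro h
    have h' : (1 : Π i, L i) ∈ ((M * M) / M) * (M / (M * M)) := by rwa [mul_comm]
    -- `(LL)·(L:LL) = L`
    have hX : (M * M) * (M / (M * M)) = M := by rw [mul_comm]; exact div_mul_eq_of_one_mem h'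
    have hE : M * (M * (M / (M * M))) = M := by rw [← mul_assoc, hX]
    have hEE : (M * (M / (M * M))) * (M * (M / (M * M))) = M * (M / (M * M)) := by
      rw [mul_mul_mul_comm, ← mul_assoc, hX]
    have hEfull : IsFullLattice (Π i, L i) (M * (M / (M * M))) :=
      isFullLattice_mul hM (isFullLattice_div hM (isFullLattice_mul hM hM))
    have hML₂ : M * (M * (M / (M * M)) * (M / (M * M))) = M * (M / (M * M)) := by
      rw [← mul_assoc, hE]
    exact mul_div_div_eq_of_exists_mul_eq ⟨_, hML₂.trans (idempotent_eq_div_self hEfull hEE hE hML₂)⟩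
  · intro hinv
    refine one_mem_div_mul_div_of_eq_mul (A := (M / M) / M) (B := M) ?_ rfl ?_
    · rw [← mul_assoc, mul_comm ((M / M) / M) M, hinv, div_self_mul_self]
    · rw [mul_comm, hinv]; exact one_mem_div_self M

omit [∀ i, NumberField (L i)] in
/-- **THEOREM 4.6, FREENESS at lattice level: if `L_3` is invertible with `𝒪(L_3) = 𝒪(L_1)` and `u·(L_3L_1) = L_1`
for a unit `u`, then `uL_3 = 𝒪(L_1)`** — i.e. `[L_3]_ε[L_1]_ε = [L_1]_ε ⟹ [L_3]_ε = [𝒪(L_1)]_ε` («if `I = IJ` with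
`I` and `J` both having multiplicator ring `S` and `J` invertible in `S`, then `J = S`»; here by the UNIQUENESS of
Thm. 5.8 (a): `uL_3` and `𝒪(L_1)` both solve `L_1·X = L_1` in `G(𝒪(L_1))`). [cite: Marseglia2019, §4 Thm. 4.6, chunk p0009] [cite: HertlingLarabi2026, §5 Thm. 5.8 (a), chunk p0013] -/
theorem units_smul_eq_div_self_of_units_smul_mul_eq {L₁ L₃ : Submodule ℤ (Π i, L i)} {u : (Π i, L i)ˣ}
    (hO : L₃ / L₃ = L₁ / L₁) (hinv : L₃ * ((L₃ / L₃) / L₃) = L₃ / L₃) (h : u • (L₃ * L₁) = L₁) :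
    u • L₃ = L₁ / L₁ := by
  have hO' : (u • L₃) / (u • L₃) = L₁ / L₁ := by rw [div_self_units_smul, hO]
  have h' : L₁ * (u • L₃) = L₁ := by rw [mul_comm, ← units_smul_mul, h]
  exact eq_div_of_invertible_mul_eq hO' (units_smul_mul_div_div_eq u hinv) h'

end Krull

/-! ## §4 The class sets `ICM_R ⊇ Pic(R)` and `W̄(R)` of an order `R`: Theorem 4.6 ∕ (5.13) and the count -/

section Classes

variable {t : Type} {L : t → Type} [∀ i, Field (L i)] [∀ i, NumberField (L i)] [Fintype t]

omit [∀ i, NumberField (L i)] [Fintype t] in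
/-- `a ∈ 𝒪(M) = M/M ⟺ Ma ⊆ M` — the bridge between g31-#2's predicate «`∀ m ∈ M, m·a ∈ M`» and the colon.
[cite: HertlingLarabi2026, §5 Lemma 5.2 (a) (`𝒪(L) := L:L`), chunk p0011] -/
theorem forall_mul_mem_iff_mem_div_self {M : Submodule ℤ (Π i, L i)} {a : Π i, L i} :
    (∀ m ∈ M, m * a ∈ M) ↔ a ∈ M / M := by
  rw [Submodule.mem_div_iff_forall_mul_mem]
  exact forall₂_congr fun m _ => by rw [mul_comm]

omit [∀ i, NumberField (L i)] [Fintype t] in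
/-- The two spellings of the stratum «order EXACTLY `S`» agree: `(∀ a, Ma ⊆ M ⟺ a ∈ S) ⟺ 𝒪(M) = R` whenever the
lattice `R` and the subring `S` have the same elements. [cite: Marseglia2019, §4 Def. 4.2 (`ICM̄(S)`, `W̄k(S)`), chunks p0008–p0009] -/
theorem forall_forall_mul_mem_iff_iff_div_self_eq {S : Subring (Π i, L i)} {R : Submodule ℤ (Π i, L i)}
    (hRS : ∀ a, a ∈ R ↔ a ∈ S) (M : Submodule ℤ (Π i, L i)) :
    (∀ a : Π i, L i, (∀ m ∈ M, m * a ∈ M) ↔ a ∈ S) ↔ M / M = R := by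
  simp only [forall_mul_mem_iff_mem_div_self, ← hRS]
  exact ⟨fun h => Submodule.ext h, fun h a => by rw [h]⟩

omit [∀ i, NumberField (L i)] [Fintype t] in
/-- **`ICM_R ≃ ICM_S`: the `ε`-classes with `𝒪(M) = R` are g31-#2's `Subring`-indexed stratum** when `R` and `S`
have the same elements (so the dictionary `nonempty_quot_sublattice_order_eq_equiv` with `Y`-isomorphism classes
of tori applies to `ICM_R`). [cite: Marseglia2019, §4 (`ICM(R) = ⊔ ICM̄(S)`), chunk p0009] [cite: HertlingLarabi2026, §5 (5.10), chunk p0013] -/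
theorem nonempty_quot_div_self_eq_equiv_quot_subring {S : Subring (Π i, L i)} {R : Submodule ℤ (Π i, L i)}
    (hRS : ∀ a, a ∈ R ↔ a ∈ S) :
    Nonempty (Quot (fun M M' : {M : Submodule ℤ (Π i, L i) //
          IsFullLattice (Π i, L i) M ∧ M / M = R} =>
        ∃ u : (Π i, L i)ˣ, u • (M : Submodule ℤ (Π i, L i)) = M') ≃
      Quot (fun M M' : {M : Submodule ℤ (Π i, L i) //
          IsFullLattice (Π i, L i) M ∧ ∀ a : Π i, L i, (∀ m ∈ M, m * a ∈ M) ↔ a ∈ S} =>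
        ∃ u : (Π i, L i)ˣ, u • (M : Submodule ℤ (Π i, L i)) = M')) :=
  ⟨Quot.congr (Equiv.subtypeEquivRight fun M => and_congr_right fun _ =>
    (forall_forall_mul_mem_iff_iff_div_self_eq hRS M).symm) fun _ _ => Iff.rfl⟩

/-- **THEOREM 6.5 for the stratum `𝒪(M) = R`: the `ε`-classes of full lattices with order EXACTLY `R` are FINITELY
MANY** («Theorem 6.5 will say that this set is finite») — g31-#2's `finite_quot_isFullLattice_order_eq` for the
subring with the elements of `R` (an order as soon as the stratum is nonempty). [cite: HertlingLarabi2026, §6 Thm. 6.5 and §5 (5.10), chunks p0015, p0013] [cite: Marseglia2019, §4 Thm. 4.6 (finite sets `W̄k(S)`, `Pic(S)`), chunk p0009] -/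
theorem finite_quot_isFullLattice_div_self_eq (R : Submodule ℤ (Π i, L i)) :
    Finite (Quot (fun M M' : {M : Submodule ℤ (Π i, L i) // IsFullLattice (Π i, L i) M ∧ M / M = R} =>
      ∃ u : (Π i, L i)ˣ, u • (M : Submodule ℤ (Π i, L i)) = M')) := by
  rcases isEmpty_or_nonempty {M : Submodule ℤ (Π i, L i) // IsFullLattice (Π i, L i) M ∧ M / M = R} with
    hE | ⟨⟨M₀, -, hM₀⟩⟩
  · exact Finite.of_surjective (Quot.mk _) Quot.mk_surjective
  · -- `R = 𝒪(M₀)` is a subring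
    let S : Subring (Π i, L i) :=
      { carrier := R
        mul_mem' := fun {a b} ha hb => by
          rw [← hM₀] at ha hb ⊢
          exact (div_self_mul_div_self_eq M₀).le (Submodule.mul_mem_mul ha hb)
        one_mem' := by rw [← hM₀]; exact one_mem_div_self M₀
        add_mem' := fun {a b} ha hb => R.add_mem ha hb
        zero_mem' := R.zero_mem
        neg_mem' := fun {a} ha => R.neg_mem ha }
    obtain ⟨e⟩ := nonempty_quot_div_self_eq_equiv_quot_subring (S := S) (R := R) fun a => Iff.rfl
    haveI := IsCMAlgTorusRat.finite_quot_isFullLattice_order_eq (L := L) S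
    exact Finite.of_equiv _ e.symm

/-- `W̄(R)` is finite (a quotient of the finite `ICM_R`: isomorphic lattices are weakly equivalent).
[cite: Marseglia2019, §4 Thm. 4.6, chunk p0009] [cite: HertlingLarabi2026, §5 (before Thm. 5.8), chunk p0013] -/
theorem finite_quot_weak_div_self_eq (R : Submodule ℤ (Π i, L i)) :
    Finite (Quot (fun M M' : {M : Submodule ℤ (Π i, L i) // IsFullLattice (Π i, L i) M ∧ M / M = R} =>
      (1 : Π i, L i) ∈ ((M : Submodule ℤ (Π i, L i)) / M') * ((M' : Submodule ℤ (Π i, L i)) / M))) := by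
  haveI := finite_quot_isFullLattice_div_self_eq (L := L) R
  refine Finite.of_surjective
    (α := Quot (fun M M' : {M : Submodule ℤ (Π i, L i) // IsFullLattice (Π i, L i) M ∧ M / M = R} =>
      ∃ u : (Π i, L i)ˣ, u • (M : Submodule ℤ (Π i, L i)) = M'))
    (Quot.lift (fun M => Quot.mk _ M) fun M M' h => Quot.sound ?_) fun q =>
    Quot.inductionOn q fun M => ⟨Quot.mk _ M, rfl⟩
  obtain ⟨u, hu⟩ := h
  exact one_mem_div_mul_div_of_units_smul_eq hu

/-- `Pic(R)` — the `ε`-classes of INVERTIBLE lattices with order `R` — is finite (it injects into `ICM_R`).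
[cite: Marseglia2019, §4 Thm. 4.6 («`Pic(S) = {[J_1], …, [J_s]}`»), chunk p0009] [cite: HertlingLarabi2026, §5 Thm. 5.8 (b) («one of them being `G([Λ]_ε)`»), chunk p0013] -/
theorem finite_quot_pic_div_self_eq (R : Submodule ℤ (Π i, L i)) :
    Finite (Quot (fun M M' : {M : Submodule ℤ (Π i, L i) //
        (IsFullLattice (Π i, L i) M ∧ M / M = R) ∧ M * ((M / M) / M) = M / M} =>
      ∃ u : (Π i, L i)ˣ, u • (M : Submodule ℤ (Π i, L i)) = M')) := by
  haveI := finite_quot_isFullLattice_div_self_eq (L := L) R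
  exact Finite.of_injective _ (IsCMAlgTorusRat.quot_map_injective_of_imp (L := L)
    (p := fun M => (IsFullLattice (Π i, L i) M ∧ M / M = R) ∧ M * ((M / M) / M) = M / M)
    (p' := fun M => IsFullLattice (Π i, L i) M ∧ M / M = R) fun M hM => hM.1)

omit [Fintype t] in
/-- **THEOREM 4.6 ∕ THEOREM 5.8 (b) (5.13): every fibre of `ICM_R → W̄(R)` is a `Pic(R)`-TORSOR** — for `[L_1]_ε ∈ ICM_R`
the map `Pic(R) → {[M]_ε | M ∼_w L_1}`, `[L_3]_ε ↦ [L_3L_1]_ε`, is a bijection (well defined and into the fibre: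
`𝒪(L_3L_1) = R`, `L_3L_1 ∼_w L_1`; injective = FREENESS `units_smul_eq_div_self_of_units_smul_mul_eq` with
uniqueness; surjective = Cor. 4.5 `M = (M:L_1)L_1`), so `#fibre = #Pic(R)` («this set decomposes into finitely many
`w`-classes which have all the same size, one of them being `G([Λ]_ε)`»).
[cite: Marseglia2019, §4 Thm. 4.6, chunk p0009] [cite: HertlingLarabi2026, §5 Thm. 5.8 (b) (5.13), chunks p0013–p0014] -/
theorem natCard_fiber_weak_eq_natCard_quot_pic (R : Submodule ℤ (Π i, L i))
    (L₁ : {M : Submodule ℤ (Π i, L i) // IsFullLattice (Π i, L i) M ∧ M / M = R}) :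
    Nat.card {q : Quot (fun M M' : {M : Submodule ℤ (Π i, L i) // IsFullLattice (Π i, L i) M ∧ M / M = R} =>
        ∃ u : (Π i, L i)ˣ, u • (M : Submodule ℤ (Π i, L i)) = M') //
        Quot.lift (fun M => Quot.mk (fun M M' : {M : Submodule ℤ (Π i, L i) //
            IsFullLattice (Π i, L i) M ∧ M / M = R} =>
          (1 : Π i, L i) ∈ ((M : Submodule ℤ (Π i, L i)) / M') * ((M' : Submodule ℤ (Π i, L i)) / M)) M)
          (fun M M' (h : ∃ u : (Π i, L i)ˣ, u • (M : Submodule ℤ (Π i, L i)) = M') =>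
            Quot.sound (one_mem_div_mul_div_of_units_smul_eq h.choose_spec)) q =
        Quot.mk _ L₁} =
    Nat.card (Quot (fun M M' : {M : Submodule ℤ (Π i, L i) //
        (IsFullLattice (Π i, L i) M ∧ M / M = R) ∧ M * ((M / M) / M) = M / M} =>
      ∃ u : (Π i, L i)ˣ, u • (M : Submodule ℤ (Π i, L i)) = M')) := by
  -- the weak relation on the stratum
  have hEw := equivalence_one_mem_div_mul_div (L := L) (fun M => IsFullLattice (Π i, L i) M ∧ M / M = R)
  -- `L_3L_1` lies in the stratum and in the weak class of `L_1`
  have hmem : ∀ L₃ : {M : Submodule ℤ (Π i, L i) //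
      (IsFullLattice (Π i, L i) M ∧ M / M = R) ∧ M * ((M / M) / M) = M / M},
      IsFullLattice (Π i, L i) (L₃.1 * L₁.1) ∧ (L₃.1 * L₁.1) / (L₃.1 * L₁.1) = R := fun L₃ => by
    have hO : L₃.1 / L₃.1 = L₁.1 / L₁.1 := by rw [L₃.2.1.2, L₁.2.2]
    have hw := one_mem_div_mul_div_of_invertible_mul_eq hO L₃.2.2 (mul_comm L₁.1 L₃.1)
    exact ⟨isFullLattice_mul L₃.2.1.1 L₁.2.1, by rw [← div_self_eq_div_self_of_one_mem hw, L₁.2.2]⟩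
  have hfiber : ∀ L₃ : {M : Submodule ℤ (Π i, L i) //
      (IsFullLattice (Π i, L i) M ∧ M / M = R) ∧ M * ((M / M) / M) = M / M},
      (1 : Π i, L i) ∈ ((L₃.1 * L₁.1) / L₁.1) * (L₁.1 / (L₃.1 * L₁.1)) := fun L₃ => by
    have hO : L₃.1 / L₃.1 = L₁.1 / L₁.1 := by rw [L₃.2.1.2, L₁.2.2]
    rw [one_mem_div_mul_div_comm]
    exact one_mem_div_mul_div_of_invertible_mul_eq hO L₃.2.2 (mul_comm L₁.1 L₃.1)
  let φ : (Quot (fun M M' : {M : Submodule ℤ (Π i, L i) //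
        (IsFullLattice (Π i, L i) M ∧ M / M = R) ∧ M * ((M / M) / M) = M / M} =>
      ∃ u : (Π i, L i)ˣ, u • (M : Submodule ℤ (Π i, L i)) = M')) →
      {q : Quot (fun M M' : {M : Submodule ℤ (Π i, L i) // IsFullLattice (Π i, L i) M ∧ M / M = R} =>
          ∃ u : (Π i, L i)ˣ, u • (M : Submodule ℤ (Π i, L i)) = M') //
        Quot.lift (fun M => Quot.mk (fun M M' : {M : Submodule ℤ (Π i, L i) //
            IsFullLattice (Π i, L i) M ∧ M / M = R} =>
          (1 : Π i, L i) ∈ ((M : Submodule ℤ (Π i, L i)) / M') * ((M' : Submodule ℤ (Π i, L i)) / M)) M)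
          (fun M M' (h : ∃ u : (Π i, L i)ˣ, u • (M : Submodule ℤ (Π i, L i)) = M') =>
            Quot.sound (one_mem_div_mul_div_of_units_smul_eq h.choose_spec)) q =
        Quot.mk _ L₁} :=
    Quot.lift (fun L₃ => ⟨Quot.mk _ ⟨L₃.1 * L₁.1, hmem L₃⟩, Quot.sound (hfiber L₃)⟩)
      fun L₃ L₃' h => Subtype.ext (Quot.sound (by
        obtain ⟨u, hu⟩ := h
        exact ⟨u, by simp only; rw [units_smul_mul, hu]⟩))
  refine (Nat.card_eq_of_bijective φ ⟨?_, ?_⟩).symm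
  · -- FREENESS: `u(L_3L_1) = L_3'L_1 ⟹ (u L_3 L_3'⁻¹) (L_3'L_1) … ⟹ uL_3 ∼_ε L_3'` via uniqueness in `G(R)`
    intro c₁ c₂ h
    induction c₁ using Quot.ind with | mk L₃ => ?_
    induction c₂ using Quot.ind with | mk L₃' => ?_
    obtain ⟨u, hu⟩ := (IsCMAlgTorusRat.equivalence_exists_units_smul_eq (L := L)
      (fun M => IsFullLattice (Π i, L i) M ∧ M / M = R)).eqvGen_iff.1
        (Quot.eqvGen_exact (congrArg Subtype.val h))
    -- `hu : u • (L₃ * L₁) = L₃' * L₁`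
    have hO₃' : L₃'.1 / L₃'.1 = L₁.1 / L₁.1 := by rw [L₃'.2.1.2, L₁.2.2]
    have huO : (u • L₃.1) / (u • L₃.1) = L₁.1 / L₁.1 := by rw [div_self_units_smul, L₃.2.1.2, L₁.2.2]
    have hu' : L₁.1 * (u • L₃.1) = L₃'.1 * L₁.1 := by
      rw [mul_comm, ← units_smul_mul]; exact hu
    -- both `uL_3` and `L_3'` solve `L_1·X = L_3'L_1` in `G(R)`: uniqueness
    have h1 := eq_div_of_invertible_mul_eq huO (units_smul_mul_div_div_eq u L₃.2.2) hu'
    have h2 := eq_div_of_invertible_mul_eq hO₃' L₃'.2.2 (mul_comm L₁.1 L₃'.1)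
    exact Quot.sound ⟨u, h1.trans h2.symm⟩
  · -- SURJECTIVITY onto the fibre: `M ∼_w L_1 ⟹ M = (M:L_1)L_1` with `M:L_1 ∈ G(R)`
    rintro ⟨q, hq⟩
    induction q using Quot.ind with | mk M => ?_
    have hw : (1 : Π i, L i) ∈ (M.1 / L₁.1) * (L₁.1 / M.1) := hEw.eqvGen_iff.1 (Quot.eqvGen_exact hq)
    have hO : (M.1 / L₁.1) / (M.1 / L₁.1) = R := by rw [div_self_div_eq_div_self_of_one_mem hw, M.2.2]
    have hL₃ : (IsFullLattice (Π i, L i) (M.1 / L₁.1) ∧ (M.1 / L₁.1) / (M.1 / L₁.1) = R) ∧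
        (M.1 / L₁.1) * (((M.1 / L₁.1) / (M.1 / L₁.1)) / (M.1 / L₁.1)) = (M.1 / L₁.1) / (M.1 / L₁.1) :=
      ⟨⟨isFullLattice_div M.2.1 L₁.2.1, hO⟩, div_mul_inv_eq_of_one_mem hw⟩
    have hw' : (1 : Π i, L i) ∈ (L₁.1 / M.1) * (M.1 / L₁.1) := by rwa [mul_comm]
    refine ⟨Quot.mk _ ⟨M.1 / L₁.1, hL₃⟩, Subtype.ext (Quot.sound ⟨1, ?_⟩)⟩
    simp only
    rw [one_smul, div_mul_eq_of_one_mem hw']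

omit [Fintype t] in
/-- `Pic(R) ⊆ ICM_R` is one fibre: the fibre over `[M]` for any invertible `M` (so `Pic(R)` is EMPTY iff `ICM_R` is —
an order `R` itself lies in `Pic(R)`). [cite: HertlingLarabi2026, §5 Thm. 5.8 (b) («one of them being `G([Λ]_ε)`»), chunk p0013] -/
theorem isEmpty_quot_pic_iff (R : Submodule ℤ (Π i, L i)) :
    IsEmpty (Quot (fun M M' : {M : Submodule ℤ (Π i, L i) //
        (IsFullLattice (Π i, L i) M ∧ M / M = R) ∧ M * ((M / M) / M) = M / M} =>
      ∃ u : (Π i, L i)ˣ, u • (M : Submodule ℤ (Π i, L i)) = M')) ↔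
    IsEmpty (Quot (fun M M' : {M : Submodule ℤ (Π i, L i) // IsFullLattice (Π i, L i) M ∧ M / M = R} =>
      ∃ u : (Π i, L i)ˣ, u • (M : Submodule ℤ (Π i, L i)) = M')) := by
  constructor
  · intro h
    by_contra hne
    rw [not_isEmpty_iff] at hne
    obtain ⟨q⟩ := hne
    induction q using Quot.ind with | mk M => ?_
    -- `R = 𝒪(M)` is an invertible member of the stratum
    have hR : (IsFullLattice (Π i, L i) R ∧ R / R = R) ∧ R * ((R / R) / R) = R / R := by
      rw [← M.2.2]
      exact ⟨⟨isFullLattice_div M.2.1 M.2.1, div_self_div_div_self M.1⟩,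
        mul_div_div_eq_of_one_mem (one_mem_div_self M.1) (div_self_mul_div_self_eq M.1).le⟩
    exact h.false (Quot.mk _ ⟨R, hR⟩)
  · intro h
    exact ⟨fun q => Quot.inductionOn q fun M => h.false (Quot.mk _ ⟨M.1, M.2.1⟩)⟩

/-- **THEOREM 4.6 COUNTED ∕ (5.13): `#ICM_R = #Pic(R) · #W̄(R)`** — the `ε`-classes of full lattices with order
EXACTLY `R` number `#Pic(R)` times the number of weak classes with order `R` («`ICM̄(S) = {[I_iJ_j] : 1 ≤ i ≤ r,
1 ≤ j ≤ s}` and the fractional ideals `I_iJ_j` are pairwise not isomorphic»; «finitely many `w`-classes which have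
all the same size»). [cite: Marseglia2019, §4 Thm. 4.6, chunk p0009] [cite: HertlingLarabi2026, §5 Thm. 5.8 (b) (5.13), chunks p0013–p0014]
[cite: DadeTausskyZassenhaus1962, §1] -/
theorem natCard_quot_div_self_eq_eq_natCard_quot_pic_mul_natCard_quot_weak (R : Submodule ℤ (Π i, L i)) :
    Nat.card (Quot (fun M M' : {M : Submodule ℤ (Π i, L i) // IsFullLattice (Π i, L i) M ∧ M / M = R} =>
        ∃ u : (Π i, L i)ˣ, u • (M : Submodule ℤ (Π i, L i)) = M')) =
    Nat.card (Quot (fun M M' : {M : Submodule ℤ (Π i, L i) //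
        (IsFullLattice (Π i, L i) M ∧ M / M = R) ∧ M * ((M / M) / M) = M / M} =>
      ∃ u : (Π i, L i)ˣ, u • (M : Submodule ℤ (Π i, L i)) = M')) *
    Nat.card (Quot (fun M M' : {M : Submodule ℤ (Π i, L i) // IsFullLattice (Π i, L i) M ∧ M / M = R} =>
      (1 : Π i, L i) ∈ ((M : Submodule ℤ (Π i, L i)) / M') * ((M' : Submodule ℤ (Π i, L i)) / M))) := by
  classical
  -- the projection `π : ICM_R → W̄(R)`
  let π : (Quot (fun M M' : {M : Submodule ℤ (Π i, L i) // IsFullLattice (Π i, L i) M ∧ M / M = R} =>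
        ∃ u : (Π i, L i)ˣ, u • (M : Submodule ℤ (Π i, L i)) = M')) →
      Quot (fun M M' : {M : Submodule ℤ (Π i, L i) // IsFullLattice (Π i, L i) M ∧ M / M = R} =>
        (1 : Π i, L i) ∈ ((M : Submodule ℤ (Π i, L i)) / M') * ((M' : Submodule ℤ (Π i, L i)) / M)) :=
    Quot.lift (fun M => Quot.mk _ M)
      (fun M M' (h : ∃ u : (Π i, L i)ˣ, u • (M : Submodule ℤ (Π i, L i)) = M') =>
        Quot.sound (one_mem_div_mul_div_of_units_smul_eq h.choose_spec))
  haveI := finite_quot_isFullLattice_div_self_eq (L := L) R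
  haveI := finite_quot_weak_div_self_eq (L := L) R
  letI := Fintype.ofFinite (Quot (fun M M' : {M : Submodule ℤ (Π i, L i) //
      IsFullLattice (Π i, L i) M ∧ M / M = R} =>
    (1 : Π i, L i) ∈ ((M : Submodule ℤ (Π i, L i)) / M') * ((M' : Submodule ℤ (Π i, L i)) / M)))
  have hfib : ∀ q₀, Nat.card {q // π q = q₀} =
      Nat.card (Quot (fun M M' : {M : Submodule ℤ (Π i, L i) //
          (IsFullLattice (Π i, L i) M ∧ M / M = R) ∧ M * ((M / M) / M) = M / M} =>
        ∃ u : (Π i, L i)ˣ, u • (M : Submodule ℤ (Π i, L i)) = M')) := fun q₀ => by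
    induction q₀ using Quot.ind with | mk L₁ => ?_
    exact natCard_fiber_weak_eq_natCard_quot_pic R L₁
  rw [Nat.card_congr (Equiv.sigmaFiberEquiv π).symm, Nat.card_sigma, Finset.sum_congr rfl fun q₀ _ => hfib q₀,
    Finset.sum_const, Finset.card_univ, ← Nat.card_eq_fintype_card, smul_eq_mul, mul_comm]

/-! ## §5 One weak class iff Gorenstein -/

omit [∀ i, NumberField (L i)] [Fintype t] in
/-- **«an ideal is invertible if and only if it is weakly equivalent to its multiplicator ring»**, COUNTED: for an
ORDER `R` (full, `1 ∈ R`, `RR ⊆ R`) there is EXACTLY ONE weak class with order `R` iff every full lattice with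
order `R` is invertible in `R` (condition (2) of Prop. 2.10) — by (5.11) `G(R) = [R]_w`.
[cite: Marseglia2019, §4 (after Def. 4.2), chunk p0008] [cite: HertlingLarabi2026, §5 Thm. 5.8 (b) (5.11), chunk p0013] -/
theorem natCard_quot_weak_div_self_eq_eq_one_iff_forall {R : Submodule ℤ (Π i, L i)}
    (hR : IsFullLattice (Π i, L i) R) (h1 : (1 : Π i, L i) ∈ R) (hRR : R * R ≤ R) :
    Nat.card (Quot (fun M M' : {M : Submodule ℤ (Π i, L i) // IsFullLattice (Π i, L i) M ∧ M / M = R} =>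
      (1 : Π i, L i) ∈ ((M : Submodule ℤ (Π i, L i)) / M') * ((M' : Submodule ℤ (Π i, L i)) / M))) = 1 ↔
    ∀ I : Submodule ℤ (Π i, L i), IsFullLattice (Π i, L i) I → I / I = R → I * (R / I) = R := by
  have hRO : R / R = R := div_self_eq_of_one_mem h1 hRR
  have hEw := equivalence_one_mem_div_mul_div (L := L) (fun M => IsFullLattice (Π i, L i) M ∧ M / M = R)
  rw [Nat.card_eq_one_iff_exists]
  constructor
  · rintro ⟨q₀, hq₀⟩ I hI hIO
    -- `[I]_w = q₀ = [R]_w`, so `I ∼_w R`, so `I` is invertible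
    have hIR : Quot.mk (fun M M' : {M : Submodule ℤ (Π i, L i) // IsFullLattice (Π i, L i) M ∧ M / M = R} =>
        (1 : Π i, L i) ∈ ((M : Submodule ℤ (Π i, L i)) / M') * ((M' : Submodule ℤ (Π i, L i)) / M))
        ⟨I, hI, hIO⟩ = Quot.mk _ ⟨R, hR, hRO⟩ := (hq₀ _).trans (hq₀ _).symm
    have hw : (1 : Π i, L i) ∈ (I / R) * (R / I) := by
      -- elaborate the relation first (its arguments are the subtype elements), then reduce the coercions
      have hw' := hEw.eqvGen_iff.1 (Quot.eqvGen_exact hIR)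
      exact hw'
    obtain ⟨-, hinv⟩ := (one_mem_div_mul_div_order_iff h1 hRR).1 hw
    rwa [hIO] at hinv
  · intro h
    refine ⟨Quot.mk _ ⟨R, hR, hRO⟩, fun q => Quot.inductionOn q fun M => Quot.sound ?_⟩
    have hinv : M.1 * ((M.1 / M.1) / M.1) = M.1 / M.1 := by
      rw [M.2.2]; exact h M.1 M.2.1 M.2.2
    exact (one_mem_div_mul_div_order_iff h1 hRR).2 ⟨M.2.2, hinv⟩

/-- **«`W̄k(S) = {[S]}` if and only if `S` is GORENSTEIN»: for an ORDER `R` there is EXACTLY ONE weak class with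
order `R` iff the trace dual `R^t` is invertible, `R^t·(R:R^t) = R`** (condition (3) of Prop. 2.10, through g31-#8's
`forall_mul_div_eq_iff_traceDual_mul_div_eq`). [cite: Marseglia2019, §4 (after Def. 4.2) with §2 Prop. 2.10, chunks p0008, p0005] [cite: HertlingLarabi2026, §5 Thm. 5.8 (b) (5.11), chunk p0013] -/
theorem natCard_quot_weak_div_self_eq_eq_one_iff {R : Submodule ℤ (Π i, L i)} (hR : IsFullLattice (Π i, L i) R)
    (h1 : (1 : Π i, L i) ∈ R) (hRR : R * R ≤ R) :
    Nat.card (Quot (fun M M' : {M : Submodule ℤ (Π i, L i) // IsFullLattice (Π i, L i) M ∧ M / M = R} =>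
      (1 : Π i, L i) ∈ ((M : Submodule ℤ (Π i, L i)) / M') * ((M' : Submodule ℤ (Π i, L i)) / M))) = 1 ↔
    (Algebra.traceForm ℚ (Π i, L i)).dualSubmodule R * (R / (Algebra.traceForm ℚ (Π i, L i)).dualSubmodule R) =
      R :=
  (natCard_quot_weak_div_self_eq_eq_one_iff_forall hR h1 hRR).trans
    (forall_mul_div_eq_iff_traceDual_mul_div_eq hR h1 hRR)

/-- **`#ICM_R = #Pic(R)` iff `R` is Gorenstein** — the CM-algebra form of «`#ICM_S = #Pic(S)` ⟺ `S` Gorenstein»: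
by the count `#ICM_R = #Pic(R)·#W̄(R)` with `#Pic(R) ≠ 0` (the order `R` is an invertible member).
[cite: Marseglia2019, §4 Thm. 4.6 with (after Def. 4.2), chunks p0009, p0008] [cite: HertlingLarabi2026, §5 Thm. 5.8 (b), chunk p0013] -/
theorem natCard_quot_div_self_eq_eq_natCard_quot_pic_iff {R : Submodule ℤ (Π i, L i)}
    (hR : IsFullLattice (Π i, L i) R) (h1 : (1 : Π i, L i) ∈ R) (hRR : R * R ≤ R) :
    Nat.card (Quot (fun M M' : {M : Submodule ℤ (Π i, L i) // IsFullLattice (Π i, L i) M ∧ M / M = R} =>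
        ∃ u : (Π i, L i)ˣ, u • (M : Submodule ℤ (Π i, L i)) = M')) =
      Nat.card (Quot (fun M M' : {M : Submodule ℤ (Π i, L i) //
          (IsFullLattice (Π i, L i) M ∧ M / M = R) ∧ M * ((M / M) / M) = M / M} =>
        ∃ u : (Π i, L i)ˣ, u • (M : Submodule ℤ (Π i, L i)) = M')) ↔
    (Algebra.traceForm ℚ (Π i, L i)).dualSubmodule R * (R / (Algebra.traceForm ℚ (Π i, L i)).dualSubmodule R) =
      R := by
  rw [← natCard_quot_weak_div_self_eq_eq_one_iff hR h1 hRR,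
    natCard_quot_div_self_eq_eq_natCard_quot_pic_mul_natCard_quot_weak R]
  have hRO : R / R = R := div_self_eq_of_one_mem h1 hRR
  haveI := finite_quot_pic_div_self_eq (L := L) R
  have hpos : 0 < Nat.card (Quot (fun M M' : {M : Submodule ℤ (Π i, L i) //
      (IsFullLattice (Π i, L i) M ∧ M / M = R) ∧ M * ((M / M) / M) = M / M} =>
    ∃ u : (Π i, L i)ˣ, u • (M : Submodule ℤ (Π i, L i)) = M')) := by
    rw [Nat.card_pos_iff]
    refine ⟨⟨Quot.mk _ ⟨R, ⟨hR, hRO⟩, ?_⟩⟩, inferInstance⟩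
    exact mul_div_div_eq_of_one_mem h1 hRR
  constructor
  · intro h
    exact Nat.eq_of_mul_eq_mul_left hpos (h.trans (mul_one _).symm)
  · intro h
    rw [h, mul_one]

end Classes

/-! ## §6 At torus level: isomorphism classes of CM-algebra tori with endomorphism order exactly `S` -/

section Torus

variable {t : Type} {L : t → Type} [∀ i, Field (L i)] [∀ i, NumberField (L i)] [Fintype t] [DecidableEq t]
variable {ι : Type} [Fintype ι] [DecidableEq ι] {E₀ : Type} [NormedAddCommGroup E₀] [NormedSpace ℂ E₀]
  {P₀ : (ι → ℝ) ≃L[ℝ] E₀} {ρ₀ : (Π i, L i) →ₐ[ℚ] Matrix ι ι ℚ} {q₀ : (Π i, L i) ≃ₗ[ℚ] (ι → ℚ)}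

/-- **THE NUMBER OF `Y`-ISOMORPHISM CLASSES OF CM-ALGEBRA TORI `(X_A, ρ_A)` (sublattice models of a reference structure
`(X₀, ρ₀)`) WITH ENDOMORPHISM ORDER `ρ_A⁻¹(M_ι(ℤ))` EXACTLY `S` IS `#Pic(S) · #W̄(S)`** — g31-#2's dictionary
`nonempty_quot_sublattice_order_eq_equiv` onto `ICM_S`, read on the lattice `R` underlying `S`, and the count of §4
(«we can compute the ideal class monoid of an order `R` if we know all its over-orders, their Picard groups and the
weak equivalence class monoid»; Shimura: «exactly `h` … not isomorphic to each other» when `S` is maximal).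
[cite: Marseglia2019, §4 Thm. 4.6 and Remark 4.7, chunk p0009] [cite: HertlingLarabi2026, §5 Thm. 5.8 (b) (5.13), chunk p0013] [cite: Shimura1998, §7.4 Prop. 17, p. 58] -/
theorem IsCMAlgTorusRat.natCard_quot_sublattice_order_eq_eq_mul (h₀ : IsCMAlgTorusRat P₀ ρ₀)
    (hq₀ : ∀ a y, q₀ (a * y) = ρ₀ a *ᵥ q₀ y) (S : Subring (Π i, L i)) (R : Submodule ℤ (Π i, L i))
    (hRS : ∀ a, a ∈ R ↔ a ∈ S) :
    Nat.card (Quot (fun A B : {A : Matrix ι ι ℤ // A.det ≠ 0 ∧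
          ∀ ρ_A : (Π i, L i) →ₐ[ℚ] Matrix ι ι ℚ,
            (∀ a, A.map (Int.cast : ℤ → ℚ) * ρ_A a = ρ₀ a * A.map (Int.cast : ℤ → ℚ)) →
            (intMatrixSubring ι).comap (ρ_A : (Π i, L i) →+* Matrix ι ι ℚ) = S} =>
        ∃ R R' : Matrix ι ι ℤ, R' * R = 1 ∧ R * R' = 1 ∧
          ∀ ρ_A ρ_B : (Π i, L i) →ₐ[ℚ] Matrix ι ι ℚ,
            (∀ a, (A : Matrix ι ι ℤ).map (Int.cast : ℤ → ℚ) * ρ_A a = ρ₀ a * (A : Matrix ι ι ℤ).map (Int.cast : ℤ → ℚ)) →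
            (∀ a, (B : Matrix ι ι ℤ).map (Int.cast : ℤ → ℚ) * ρ_B a = ρ₀ a * (B : Matrix ι ι ℤ).map (Int.cast : ℤ → ℚ)) →
            ∀ a, R.map (Int.cast : ℤ → ℚ) * ρ_A a = ρ_B a * R.map (Int.cast : ℤ → ℚ))) =
    Nat.card (Quot (fun M M' : {M : Submodule ℤ (Π i, L i) //
        (IsFullLattice (Π i, L i) M ∧ M / M = R) ∧ M * ((M / M) / M) = M / M} =>
      ∃ u : (Π i, L i)ˣ, u • (M : Submodule ℤ (Π i, L i)) = M')) *
    Nat.card (Quot (fun M M' : {M : Submodule ℤ (Π i, L i) // IsFullLattice (Π i, L i) M ∧ M / M = R} =>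
      (1 : Π i, L i) ∈ ((M : Submodule ℤ (Π i, L i)) / M') * ((M' : Submodule ℤ (Π i, L i)) / M))) := by
  obtain ⟨e₁⟩ := h₀.nonempty_quot_sublattice_order_eq_equiv hq₀ S
  obtain ⟨e₂⟩ := nonempty_quot_div_self_eq_equiv_quot_subring (L := L) hRS
  rw [Nat.card_congr (e₁.trans e₂.symm), natCard_quot_div_self_eq_eq_natCard_quot_pic_mul_natCard_quot_weak R]

end Torus

end Literature.NumberTheory.ComplexMultiplication
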